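import Literature.NumberTheory.LFunctions.RodgersTaoWeakEnergyBlockProofs
import Literature.NumberTheory.LFunctions.RodgersTaoTruncEnergyLemma18Proofs
import HarnessLib

/-!
# Rodgers–Tao 2020, Lemma 18 (= v4 Lemma 7.3), the a.e.-finiteness of the truncated energy `Ẽ_T`
— RH-FREE CONTENT (absolute integrability in time of (67) by Tonelli from Proposition 15)

Proofs only: no named facts and no `def`s.  Trunk T-ANT (`Literature/NumberTheory/LFunctions`).
Companion of `RodgersTaoTruncEnergyLemma18Proofs.lean` (rt-t7), whose as-printed reduction
`rodgers_tao_truncEnergy_expansion_of_cor33_location` takes the a.e.-finiteness of `Ẽ_T` on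
`[t₀/2, 0]` as an INLINE hypothesis `hfin`; the present file proves exactly that hypothesis
(`ae_summable_truncEnergyTerm_of_cor33_location`) from Proposition 15
(`rodgers_tao_weak_energy_bound_block_of`, `exists_far_interactionEnergy_sum_le`), the three
regimes (62) of `V`, the weight (66) and the location law (50), by Tonelli — the printed road.

Source: B. Rodgers, T. Tao, *The de Bruijn–Newman constant is non-negative*, Forum Math. Pi 8
(2020) e6 = arXiv:1801.05914, §7 p. 42, the sentence after display (67) (= v5 TeX chunk
p0019:L101, OPENED): «We introduce the smoothly truncated renormalized energy
`Ẽ_T(t) := Σ_{j,k ∈ ℤ*: j ≠ k} ψ_T(j)ψ_T(k)Ẽ_{jk}(t)` for `Λ/2 ≤ t ≤ 0`. This is clearly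
non-negative, and from Proposition 15, (66), (62), and Fubini's theorem we see that `Ẽ_T` is
absolutely integrable in time (in particular, it is finite for almost every `Λ/2 ≤ t ≤ 0`).»

LINE 1 — LABEL. **RH-FREE CONTENT** (0 named facts, 0 `def`s, 0 sorries): statements about the
zeros `x_j(t)` of `H_t` at times `t ∈ [t₁, t₂]` lying above a real-rooted time `t₀ < t₁` and obeying
a (50)-shape location law on `[t₁, t₂]` TAKEN AS A HYPOTHESIS (the INNER shape of
`RodgersTao2020.cor33_location`, verbatim the binder of `rodgers_tao_weak_energy_bound_block_of`),
and — in the last theorem — under `RodgersTao2020.cor33_location` itself (CONTENT-proved in the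
tree as `cor33_location_content`, Dobner-free).  Nothing is asserted about `Λ`; no use is made of
`Λ ≥ 0`; the as-printed Lemma 18 record `rodgers_tao_truncEnergy_expansion` is not touched here
(its CONTENT proof is the inline composition named under «Contents»; the ex-falso `_holds` of record
stays).  bears_on: N-C/N-P (COLUMN 3 DBN).  WHAT THIS IS NOT:
not a statement at `t = 0` alone, not a statement about `H_0` or `ζ`, not progress toward RH —
formalising the printed sentence fixes which inputs (Proposition 15, (62), (66), (50)) the
a.e.-finiteness needs; nothing in this file bears on the truth of the Riemann hypothesis.

## Contents (source item → declaration → status; namespace `Literature.NumberTheory.LFunctions`)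

* p. 42 after (67), «absolutely integrable in time» →
  `RodgersTaoTruncEnergyIntegrable.lintegral_tsum_truncEnergyTerm_ne_top`:
  `∫⁻_{[t₁,t₂]} Σ'_{(j,k)} ofReal(ψ_T(j)ψ_T(k)Ẽ_{jk}(t)) dt ≠ ⊤` (`Λ ≤ t₀ < t₁ < t₂`, (50) on
  `[t₁, t₂]`, `T log T > 0`). PROVED (CONTENT).
* p. 42 after (67), «finite for almost every `t`» →
  `RodgersTao2020.ae_summable_truncEnergyTerm_of_location` (location-law form on any `[t₁, t₂]`)
  and `ae_summable_truncEnergyTerm_of_cor33_location` (the exact `hfin` binder of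
  `rodgers_tao_truncEnergy_expansion_of_cor33_location`: `cor33_location → ∀ t₀ < 0,
  HasOnlyRealZeros (H_{t₀}) → ∃ T₁ (= 3), ∀ T ≥ T₁, ∀ᵐ t ∈ [t₀/2, 0], Summable (truncEnergyTerm T t)`).
  PROVED (CONTENT).
* Lemma 18 AS PRINTED, by content: the closed term
  `rodgers_tao_truncEnergy_expansion_of_cor33_location RodgersTao2020.cor33_location_content
  (ae_summable_truncEnergyTerm_of_cor33_location RodgersTao2020.cor33_location_content) :
  rodgers_tao_truncEnergy_expansion` (rt-t7 p454545 ∘ rt-t6 `RodgersTaoLocationUniformProofs` ∘ this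
  file) is a Dobner-free proof term of the as-printed record; it is NOT given a name here because the
  gate's `dedup.landed` identifies any second theorem of that `Prop` with the ex-falso discharge of
  record `rodgers_tao_truncEnergy_expansion_holds` (importable through this file's imports) —
  consumers write the composition inline.
* Toolkit (namespace `RodgersTaoTruncEnergyIntegrable`, public, reusable by the §7 chain):
  `renormEnergyZ_le_three_regimes` ((62): `Ẽ_{jk} ≤ 2E_{jk} + 8/(ξ_k − ξ_j)² + 2|x_k − x_j|/|ξ_k − ξ_j|³`),
  `exists_tfree_bound` (the two `t`-free pieces are `≤ K(2 + |j|)⁴(2 + |k|)⁴` under (50), from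
  (43)–(44)), `abs_deBruijnZeroZ_le`, `inv_abs_sub_le`, `interactionEnergy_neg_neg` (the tree's
  `continuousAt_renormPotential` of `RodgersTaoEnergyV5.lean` is reused, not restated),
  `interactionEnergy_le_of_far` / `tsum_indicator_far_le` (Proposition 15's far field at one far
  index / as an `ℝ≥0∞` row sum), `sum_near_le_sum_offDiag`, `row_le_of_big` / `row_lt_top_of_small`
  / `row_neg` (row bounds of `Σ_j ∫ ψψE_{jk}`), `truncWeight_le_pow_div` /
  `truncWeight_mul_pow_le` / `summable_truncWeight(_mul_pow)` (polynomial majorants of (66)),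
  continuity/measurability in `t` of `Ẽ_{jk}`, `E_{jk}`; private (folklore plumbing):
  `exists_logPlus_pow_le` (`log₊^α x ≤ C_α(2 + |x|)`), `exists_threshold` (`2⌈D log₊² n⌉ ≤ n`
  eventually), `logPlus_le_one_add_abs`, `summable_one_div_one_add_abs_sq`,
  `summable_of_tsum_ofReal_ne_top`.

## Proof route and divergences (rt/REFEREE §6)

* The printed «Proposition 15, (66), (62), Fubini»: termwise (62) gives
  `Ẽ_{jk} ≤ 2E_{jk} + 8/(ξ_k − ξ_j)² + 2|x_k − x_j|/|ξ_k − ξ_j|³` (`renormEnergyZ_le_three_regimes`);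
  the two `t`-free pieces are bounded CRUDELY by `K(2 + |j|)⁴(2 + |k|)⁴` ((44) lower half,
  `log₊ y ≤ 1 + |y|`, (43), (50)) and summed against `ψ_T(j)(2 + |j|)⁴` — no two-ray bookkeeping,
  since only finiteness (not the `o(T log³ T)` size of (68)) is claimed here.
* The `E`-piece is summed row by row in `k ∈ ℤ*` (rows are even in `k`, `row_neg`): for
  `k ≥ K₀` (where `2⌈D log₊² k⌉ ≤ k`, `exists_threshold`) the far indices `|k − j| ≥ ⌈D log₊² k⌉`
  have all finite partial sums `≤ C` pointwise in `t` (`exists_far_interactionEnergy_sum_le` with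
  `M = k`), the near ones lie with `k` in the single block `[⌈k/2⌉, ⌊3k/2⌋]_{ℤ*}` of Proposition 15
  (`rodgers_tao_weak_energy_bound_block_of`, `κ = 3`, `J = k/2`), whose opaque exponent `α` is
  absorbed by `log₊^α ≤ C_α(2 + ·)`; the finitely many rows `|k| < K₀` are finite because the far
  field bounds `E_{jk} ≤ C` for `|j| ≥ 2K₀` (roles swapped, reflected for `j < 0`) and
  `t ↦ E_{jk}(t)` is continuous on the compact interval for the rest.  This is Proposition 15 used
  exactly as printed (integrated, not pointwise: the pointwise gap floors of Proposition 13 would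
  not suffice).
* Tonelli is run in `ℝ≥0∞` (`lintegral_tsum`, `ENNReal.tsum_prod'`, `ENNReal.tsum_comm`), so no
  summability side condition arises before the last line (`ae_lt_top'` +
  `summable_of_tsum_ofReal_ne_top`, non-negativity from `truncEnergyTerm_nonneg`).
* `T log T > 0` stands for «`T` large» (only the positivity of `ψ_T` is used; `T₁ = 3` in the
  `[t₀/2, 0]` form to match rt-t7's reduction).

## References

* B. Rodgers, T. Tao, *The de Bruijn–Newman constant is non-negative*, Forum Math. Pi 8 (2020)
  e6, §7 p. 42 (sentence after (67)), Proposition 15 pp. 38–39, (62) p. 40, (66)–(67) p. 42;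
  §3 Lemma 8 (43)–(44) p. 21, Corollary 10 (50) p. 23 = arXiv:1801.05914v5 TeX chunk p0019:L95–L101.
-/

noncomputable section

open Real Filter Set Topology MeasureTheory
open scoped ENNReal

namespace Literature.NumberTheory.LFunctions

namespace RodgersTaoTruncEnergyIntegrable

/-! ### Generic summability tools -/

/-- A non-negative real family whose `ofReal`-series is finite in `ℝ≥0∞` is summable. [folklore] -/
private theorem summable_of_tsum_ofReal_ne_top {ι : Type*} {f : ι → ℝ} (hf : ∀ i, 0 ≤ f i)
    (h : ∑' i, ENNReal.ofReal (f i) ≠ ⊤) : Summable f := by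
  have h1 : ∑' i, ((Real.toNNReal (f i) : NNReal) : ENNReal) ≠ ⊤ := by
    simpa [ENNReal.ofReal] using h
  have h2 : Summable fun i ↦ Real.toNNReal (f i) := ENNReal.tsum_coe_ne_top_iff_summable.1 h1
  have h3 : Summable fun i ↦ ((Real.toNNReal (f i) : NNReal) : ℝ) := NNReal.summable_coe.2 h2
  refine h3.congr fun i ↦ ?_
  simp [Real.coe_toNNReal _ (hf i)]

/-- `ψ_T(j) ≤ max(1, T log T)^m / (1 + |j|)^m` for `m ≤ 100` (`T log T > 0`).
[cite: RodgersTaoFMP2020, §7 p. 42 (66)] -/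
theorem truncWeight_le_pow_div {T : ℝ} (hT : 0 < T * Real.log T) {m : ℕ} (hm : m ≤ 100) (j : ℤ) :
    truncWeight T j ≤ max 1 (T * Real.log T) ^ m / (1 + |(j : ℝ)|) ^ m := by
  set N : ℝ := T * Real.log T with hN
  set N' : ℝ := max 1 N with hN'
  have hN'1 : 1 ≤ N' := le_max_left _ _
  have hN'0 : 0 < N' := by linarith
  have hNN' : N ≤ N' := le_max_right _ _
  have hj0 : 0 ≤ |(j : ℝ)| := abs_nonneg _
  have hbase : (1 + |(j : ℝ)|) / N' ≤ 1 + |(j : ℝ)| / N := by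
    rw [add_div]
    have h1 : 1 / N' ≤ 1 := by
      rw [div_le_one hN'0]; exact hN'1
    have h2 : |(j : ℝ)| / N' ≤ |(j : ℝ)| / N :=
      div_le_div_of_nonneg_left hj0 hT hNN'
    linarith
  have hbase0 : 0 ≤ (1 + |(j : ℝ)|) / N' := by positivity
  have hone : 1 ≤ 1 + |(j : ℝ)| / N := by
    have : 0 ≤ |(j : ℝ)| / N := by positivity
    linarith
  have hpow : ((1 + |(j : ℝ)|) / N') ^ m ≤ (1 + |(j : ℝ)| / N) ^ 100 :=
    (pow_le_pow_left₀ hbase0 hbase m).trans (pow_le_pow_right₀ hone hm)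
  have hpos : 0 < ((1 + |(j : ℝ)|) / N') ^ m := by positivity
  rw [truncWeight_eq]
  calc ((1 + |(j : ℝ)| / (T * Real.log T)) ^ 100)⁻¹ ≤ (((1 + |(j : ℝ)|) / N') ^ m)⁻¹ := by
        rw [← hN]; exact inv_anti₀ hpos hpow
    _ = N' ^ m / (1 + |(j : ℝ)|) ^ m := by
        rw [div_pow, inv_div]

/-- `ψ_T(j) (2 + |j|)^m ≤ 2^m max(1, T log T)^{m+2} / (1 + |j|)²` for `m ≤ 98`.
[cite: RodgersTaoFMP2020, §7 p. 42 (66)] -/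
theorem truncWeight_mul_pow_le {T : ℝ} (hT : 0 < T * Real.log T) {m : ℕ} (hm : m ≤ 98) (j : ℤ) :
    truncWeight T j * (2 + |(j : ℝ)|) ^ m ≤
      2 ^ m * max 1 (T * Real.log T) ^ (m + 2) / (1 + |(j : ℝ)|) ^ 2 := by
  have h1 := truncWeight_le_pow_div hT (m := m + 2) (by omega) j
  have hj0 : 0 ≤ |(j : ℝ)| := abs_nonneg _
  have h2 : (2 + |(j : ℝ)|) ^ m ≤ 2 ^ m * (1 + |(j : ℝ)|) ^ m := by
    rw [← mul_pow]; exact pow_le_pow_left₀ (by positivity) (by linarith) m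
  have hA : 0 ≤ max 1 (T * Real.log T) ^ (m + 2) / (1 + |(j : ℝ)|) ^ (m + 2) := by positivity
  calc truncWeight T j * (2 + |(j : ℝ)|) ^ m
      ≤ (max 1 (T * Real.log T) ^ (m + 2) / (1 + |(j : ℝ)|) ^ (m + 2)) * (2 ^ m * (1 + |(j : ℝ)|) ^ m) :=
        mul_le_mul h1 h2 (by positivity) hA
    _ = 2 ^ m * max 1 (T * Real.log T) ^ (m + 2) / (1 + |(j : ℝ)|) ^ 2 := by
        have h3 : (1 + |(j : ℝ)|) ^ (m + 2) = (1 + |(j : ℝ)|) ^ 2 * (1 + |(j : ℝ)|) ^ m := by ring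
        rw [h3]
        have h4 : (1 + |(j : ℝ)|) ^ m ≠ 0 := by positivity
        field_simp

/-- `Σ_{j ∈ ℤ} 1/(1 + |j|)² < ∞`. [folklore] -/
private theorem summable_one_div_one_add_abs_sq : Summable fun j : ℤ ↦ 1 / (1 + |(j : ℝ)|) ^ 2 := by
  have hnat : Summable fun n : ℕ ↦ 1 / (1 + (n : ℝ)) ^ 2 := by
    have := (Real.summable_one_div_nat_pow (p := 2)).2 one_lt_two
    have h := (summable_nat_add_iff 1).2 this
    refine h.congr fun n ↦ ?_
    push_cast
    ring
  refine Summable.of_nat_of_neg ?_ ?_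
  · refine hnat.congr fun n ↦ ?_
    simp [Nat.abs_cast]
  · refine hnat.congr fun n ↦ ?_
    simp [abs_neg, Nat.abs_cast]

/-- `Σ_{j ∈ ℤ} ψ_T(j) (2 + |j|)^m < ∞` for `m ≤ 98`. [cite: RodgersTaoFMP2020, §7 p. 42 (66)] -/
theorem summable_truncWeight_mul_pow {T : ℝ} (hT : 0 < T * Real.log T) {m : ℕ} (hm : m ≤ 98) :
    Summable fun j : ℤ ↦ truncWeight T j * (2 + |(j : ℝ)|) ^ m := by
  refine Summable.of_nonneg_of_le (fun j ↦ mul_nonneg (truncWeight_pos hT j).le (by positivity))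
    (fun j ↦ truncWeight_mul_pow_le hT hm j) ?_
  have := summable_one_div_one_add_abs_sq.mul_left (2 ^ m * max 1 (T * Real.log T) ^ (m + 2))
  refine this.congr fun j ↦ ?_
  ring

/-- `ψ_T` is summable over `ℤ`. [cite: RodgersTaoFMP2020, §7 p. 42 (66)] -/
theorem summable_truncWeight {T : ℝ} (hT : 0 < T * Real.log T) :
    Summable fun j : ℤ ↦ truncWeight T j := by
  simpa using summable_truncWeight_mul_pow hT (m := 0) (by norm_num)

/-- `log₊ x ≤ 1 + |x|`. [folklore] -/
private theorem logPlus_le_one_add_abs (x : ℝ) : logPlus x ≤ 1 + |x| := by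
  rw [logPlus_eq]
  have h := Real.log_le_sub_one_of_pos (show (0 : ℝ) < 2 + |x| by positivity)
  linarith

/-- `log₊ x ≤ 2 + |x|`. [folklore] -/
private theorem logPlus_le_two_add_abs (x : ℝ) : logPlus x ≤ 2 + |x| := by
  have := logPlus_le_one_add_abs x; linarith

/-- Powers of `log₊` grow at most linearly: `log₊(x)^α ≤ C_α (2 + |x|)`. [folklore] -/
private theorem exists_logPlus_pow_le (α : ℕ) : ∃ Cα : ℝ, 0 < Cα ∧ ∀ x : ℝ, logPlus x ^ α ≤ Cα * (2 + |x|) := by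
  rcases Nat.eq_zero_or_pos α with rfl | hα
  · refine ⟨1, one_pos, fun x ↦ ?_⟩
    have : 0 ≤ |x| := abs_nonneg x
    simp only [pow_zero]; linarith
  refine ⟨(α : ℝ) ^ α, by positivity, fun x ↦ ?_⟩
  have hy : 0 < 2 + |x| := by positivity
  have hε : 0 < (1 : ℝ) / α := by positivity
  have h1 : Real.log (2 + |x|) ≤ (2 + |x|) ^ ((1 : ℝ) / α) / (1 / α) :=
    Real.log_le_rpow_div hy.le hε
  have h2 : Real.log (2 + |x|) ≤ α * (2 + |x|) ^ ((1 : ℝ) / α) := by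
    rw [div_div_eq_mul_div, div_one, mul_comm] at h1
    exact h1
  have h0 : 0 ≤ Real.log (2 + |x|) := Real.log_nonneg (by linarith [abs_nonneg x])
  rw [logPlus_eq]
  calc Real.log (2 + |x|) ^ α ≤ (α * (2 + |x|) ^ ((1 : ℝ) / α)) ^ α :=
        pow_le_pow_left₀ h0 h2 α
    _ = (α : ℝ) ^ α * (2 + |x|) := by
        rw [mul_pow, ← Real.rpow_natCast ((2 + |x|) ^ ((1 : ℝ) / α)) α, ← Real.rpow_mul hy.le]
        have : (1 : ℝ) / α * α = 1 := by field_simp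
        rw [this, Real.rpow_one]

/-- The far-field threshold `L_n := ⌈D log₊² n⌉` is eventually at most `n/2`. [folklore] -/
private theorem exists_threshold (D : ℝ) :
    ∃ K₀ : ℕ, 2 ≤ K₀ ∧ ∀ n : ℕ, K₀ ≤ n → 2 * ((⌈D * logPlus (n : ℝ) ^ 2⌉₊ : ℕ) : ℝ) ≤ n := by
  -- `log(x)²/(x − 2) → 0`, evaluated along `x = n + 2`
  have h1 : Tendsto (fun x : ℝ ↦ Real.log x ^ 2 / (1 * x + -2)) atTop (𝓝 0) :=
    Real.tendsto_pow_log_div_mul_add_atTop 1 (-2) 2 one_ne_zero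
  have h2 : Tendsto (fun n : ℕ ↦ (n : ℝ) + 2) atTop atTop :=
    tendsto_natCast_atTop_atTop.atTop_add tendsto_const_nhds
  have h3 := h1.comp h2
  have h4 : ∀ᶠ n : ℕ in atTop,
      |D| * (Real.log ((n : ℝ) + 2) ^ 2 / (1 * ((n : ℝ) + 2) + -2)) ≤ 1 / 4 := by
    have := h3.const_mul |D|
    rw [mul_zero] at this
    exact this.eventually (ge_mem_nhds (by norm_num : (0 : ℝ) < 1 / 4))
  obtain ⟨K₁, hK₁⟩ := eventually_atTop.1 h4
  refine ⟨max K₁ 8, le_trans (by norm_num) (le_max_right _ _), fun n hn ↦ ?_⟩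
  have hn1 : K₁ ≤ n := le_trans (le_max_left _ _) hn
  have hn8 : (8 : ℝ) ≤ n := by exact_mod_cast le_trans (le_max_right _ _) hn
  have hn0 : (0 : ℝ) < n := by linarith
  have key := hK₁ n hn1
  have hsimp : (1 : ℝ) * ((n : ℝ) + 2) + -2 = n := by ring
  simp only [hsimp] at key
  -- `|D| log²(n+2) ≤ n/4`
  have hlog : |D| * Real.log ((n : ℝ) + 2) ^ 2 ≤ n / 4 := by
    have : |D| * Real.log ((n : ℝ) + 2) ^ 2 = |D| * (Real.log ((n : ℝ) + 2) ^ 2 / n) * n := by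
      field_simp
    rw [this]
    have := mul_le_mul_of_nonneg_right key hn0.le
    linarith
  have hlp : logPlus (n : ℝ) = Real.log ((n : ℝ) + 2) := by
    rw [logPlus_eq, Nat.abs_cast, add_comm]
  have hy0 : 0 ≤ |D| * logPlus (n : ℝ) ^ 2 := by positivity
  have hceil : ((⌈D * logPlus (n : ℝ) ^ 2⌉₊ : ℕ) : ℝ) ≤ n / 4 + 1 := by
    have hmono : ⌈D * logPlus (n : ℝ) ^ 2⌉₊ ≤ ⌈|D| * logPlus (n : ℝ) ^ 2⌉₊ :=
      Nat.ceil_mono (mul_le_mul_of_nonneg_right (le_abs_self D) (sq_nonneg _))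
    have hlt : ((⌈|D| * logPlus (n : ℝ) ^ 2⌉₊ : ℕ) : ℝ) < |D| * logPlus (n : ℝ) ^ 2 + 1 :=
      Nat.ceil_lt_add_one hy0
    have hmono' : ((⌈D * logPlus (n : ℝ) ^ 2⌉₊ : ℕ) : ℝ) ≤ ((⌈|D| * logPlus (n : ℝ) ^ 2⌉₊ : ℕ) : ℝ) := by
      exact_mod_cast hmono
    rw [← hlp] at hlog
    linarith
  linarith

/-! ### The three regimes of `V`: a pointwise majorant of `Ẽ_{jk}` -/

/-- `E_{(−j)(−k)} = E_{jk}` (oddness `x_{−j} = −x_j`). [cite: RodgersTaoFMP2020, §4 p. 29 (58)] -/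
theorem interactionEnergy_neg_neg (t : ℝ) (j k : ℤ) :
    interactionEnergy t (-j) (-k) = interactionEnergy t j k := by
  rw [interactionEnergy_eq, interactionEnergy_eq, deBruijnZeroZ_neg, deBruijnZeroZ_neg]
  ring

/-- **Pointwise majorant of `Ẽ_{jk}(t)`** by the three regimes (62) of `V`
(`V(x) ≤ 2/x²` for `|x| ≤ ½`, `V(x) ≤ 8` for `½ ≤ |x| ≤ 2`, `V(x) ≤ 2|x|` for `|x| ≥ 2`):
`Ẽ_{jk}(t) ≤ 2 E_{jk}(t) + 8/(ξ_k − ξ_j)² + 2 |x_k(t) − x_j(t)| / |ξ_k − ξ_j|³` (`t > Λ`, `j ≠ k`).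
[cite: RodgersTaoFMP2020, §7 p. 40 (62)] -/
theorem renormEnergyZ_le_three_regimes {t : ℝ}
    (hΛ : ∃ t₁ : ℝ, t₁ < t ∧ HasOnlyRealZeros (deBruijnH t₁)) {j k : ℤ} (hjk : j ≠ k) :
    renormEnergyZ t j k ≤ 2 * interactionEnergy t j k
      + 8 / (classicalLocationZ k - classicalLocationZ j) ^ 2
      + 2 * |deBruijnZeroZ t k - deBruijnZeroZ t j| / |classicalLocationZ k - classicalLocationZ j| ^ 3 := by
  set a : ℝ := deBruijnZeroZ t k - deBruijnZeroZ t j with ha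
  set b : ℝ := classicalLocationZ k - classicalLocationZ j with hb
  have ha0 : a ≠ 0 := deBruijnZeroZ_sub_ne_zero hΛ hjk
  have hb0 : b ≠ 0 := classicalLocationZ_sub_ne_zero hjk
  have hx0 : a / b ≠ 0 := div_ne_zero ha0 hb0
  have hE : interactionEnergy t j k = 1 / a ^ 2 := by
    rw [interactionEnergy_eq, ha, ← neg_sub, neg_sq]
  have hV : renormEnergyZ t j k = renormPotential (a / b) / b ^ 2 := by
    rw [renormEnergyZ_eq]
  have hapos : 0 < |a| := abs_pos.2 ha0
  have hbpos : 0 < |b| := abs_pos.2 hb0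
  have hb2 : 0 < b ^ 2 := by positivity
  have hT1 : 0 ≤ 2 * interactionEnergy t j k := by rw [hE]; positivity
  have hT2 : 0 ≤ 8 / b ^ 2 := by positivity
  have hT3 : 0 ≤ 2 * |a| / |b| ^ 3 := by positivity
  rw [hV]
  have habs : |a / b| = |a| / |b| := abs_div a b
  rcases le_or_gt |a / b| (1 / 2) with h1 | h1
  · -- small regime: `V(a/b)/b² ≤ 2/a² = 2 E_{jk}`
    have hle := renormPotential_le_of_abs_le_half hx0 h1
    have : renormPotential (a / b) / b ^ 2 ≤ 2 * interactionEnergy t j k := by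
      rw [hE]
      calc renormPotential (a / b) / b ^ 2 ≤ (2 / (a / b) ^ 2) / b ^ 2 :=
            div_le_div_of_nonneg_right hle hb2.le
        _ = 2 * (1 / a ^ 2) := by field_simp
    linarith
  rcases lt_or_ge |a / b| 2 with h2 | h2
  · -- middle regime: `V(a/b) ≤ 8 (|a/b| − 1)² ≤ 8`
    have hle := renormPotential_le_eight_mul_sq (x := a / b) h1.le
    have hsq : (|a / b| - 1) ^ 2 ≤ 1 := by
      have h0 : 0 ≤ |a / b| := abs_nonneg _
      nlinarith
    have : renormPotential (a / b) / b ^ 2 ≤ 8 / b ^ 2 :=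
      div_le_div_of_nonneg_right (by nlinarith) hb2.le
    linarith
  · -- large regime: `V(a/b) ≤ 2|a/b|`
    have hle := renormPotential_le_two_mul_abs (x := a / b) h2
    have : renormPotential (a / b) / b ^ 2 ≤ 2 * |a| / |b| ^ 3 := by
      calc renormPotential (a / b) / b ^ 2 ≤ (2 * |a / b|) / b ^ 2 :=
            div_le_div_of_nonneg_right hle hb2.le
        _ = 2 * |a| / |b| ^ 3 := by
            rw [habs, ← sq_abs b]
            field_simp
    linarith

/-! ### The `t`-free pieces: a polynomial majorant -/

/-- Under the (50)-shape location law at time `t`: `|x_j(t)| ≤ B_ξ |j| + max(B,0) C₈ log₊ j` for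
every `j ∈ ℤ` (`|ξ_j| ≤ B_ξ |j|` from (43), deviation from `abs_deviation_le`).
[cite: RodgersTaoFMP2020, Corollary 10 (50) p. 23; Lemma 8 (43) p. 21] -/
theorem abs_deBruijnZeroZ_le {Bξ C₈ c₈ : ℝ} (h43 : ∀ k : ℤ, |classicalLocationZ k| ≤ Bξ * |(k : ℝ)|)
    (h8 : ∀ y : ℝ, 1 ≤ y → c₈ * logPlus y ≤ logPlus (classicalLocation y) ∧
      logPlus (classicalLocation y) ≤ C₈ * logPlus y)
    {t B : ℝ}
    (h50 : ∀ n : ℕ, 1 ≤ n →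
      |deBruijnZero t n - classicalLocation (n : ℝ)| ≤ B * logPlus (classicalLocation (n : ℝ)))
    (j : ℤ) :
    |deBruijnZeroZ t j| ≤ Bξ * |(j : ℝ)| + max B 0 * C₈ * logPlus j := by
  have h1 := RodgersTaoTruncEnergyExpansion.abs_deviation_le h8 h50 j
  have h2 := h43 j
  have h3 : |deBruijnZeroZ t j| ≤ |classicalLocationZ j| + |deBruijnZeroZ t j - classicalLocationZ j| := by
    have := abs_add_le (classicalLocationZ j) (deBruijnZeroZ t j - classicalLocationZ j)
    rwa [add_sub_cancel] at this
  linarith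

/-- `1/|ξ_k − ξ_j| ≤ (1 + B_ξ)(2 + |j|)(2 + |k|)/c` for distinct `j, k ∈ ℤ*` (from the lower half
of (44): `c (k − j)/log₊(|ξ_j| + |ξ_k|) ≤ |ξ_k − ξ_j|`, `log₊ y ≤ 1 + |y|` and `|ξ_k| ≤ B_ξ |k|`).
[cite: RodgersTaoFMP2020, Lemma 8 (43)–(44) p. 21] -/
theorem inv_abs_sub_le {c Bξ : ℝ} (hc : 0 < c) (hBξ : 0 < Bξ)
    (h44 : ∀ j k : ℤ, j ≠ 0 → k ≠ 0 →
      c * (|(k : ℝ) - j| / logPlus (|classicalLocationZ j| + |classicalLocationZ k|)) ≤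
        |classicalLocationZ k - classicalLocationZ j|)
    (h43 : ∀ k : ℤ, |classicalLocationZ k| ≤ Bξ * |(k : ℝ)|)
    {j k : ℤ} (hj : j ≠ 0) (hk : k ≠ 0) (hjk : j ≠ k) :
    1 / |classicalLocationZ k - classicalLocationZ j| ≤
      (1 + Bξ) * ((2 + |(j : ℝ)|) * (2 + |(k : ℝ)|)) / c := by
  have hb0 : classicalLocationZ k - classicalLocationZ j ≠ 0 := classicalLocationZ_sub_ne_zero hjk
  have hbpos : 0 < |classicalLocationZ k - classicalLocationZ j| := abs_pos.2 hb0
  have hL0 : 0 < logPlus (|classicalLocationZ j| + |classicalLocationZ k|) := logPlus_pos _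
  have hkj : (1 : ℝ) ≤ |(k : ℝ) - j| := by
    have : (1 : ℤ) ≤ |k - j| := Int.one_le_abs (sub_ne_zero.2 (Ne.symm hjk))
    have h' : ((1 : ℤ) : ℝ) ≤ ((|k - j| : ℤ) : ℝ) := by exact_mod_cast this
    simpa [Int.cast_abs, Int.cast_sub] using h'
  have h1 := h44 j k hj hk
  -- `c / log₊(…) ≤ |ξ_k − ξ_j|`
  have h2 : c / logPlus (|classicalLocationZ j| + |classicalLocationZ k|) ≤
      |classicalLocationZ k - classicalLocationZ j| := by
    refine le_trans ?_ h1
    rw [mul_div_assoc']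
    exact div_le_div_of_nonneg_right (by nlinarith) hL0.le
  -- `log₊(|ξ_j| + |ξ_k|) ≤ 1 + B_ξ(|j| + |k|) ≤ (1 + B_ξ)(2 + |j|)(2 + |k|)`
  have h3 : logPlus (|classicalLocationZ j| + |classicalLocationZ k|) ≤
      (1 + Bξ) * ((2 + |(j : ℝ)|) * (2 + |(k : ℝ)|)) := by
    have hy : 0 ≤ |classicalLocationZ j| + |classicalLocationZ k| := by positivity
    have h31 := logPlus_le_one_add_abs (|classicalLocationZ j| + |classicalLocationZ k|)
    rw [abs_of_nonneg hy] at h31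
    have hj' := h43 j
    have hk' := h43 k
    have hj0 : 0 ≤ |(j : ℝ)| := abs_nonneg _
    have hk0 : 0 ≤ |(k : ℝ)| := abs_nonneg _
    nlinarith [mul_nonneg hj0 hk0, mul_nonneg hBξ.le (mul_nonneg hj0 hk0)]
  have h4 : 0 < (1 + Bξ) * ((2 + |(j : ℝ)|) * (2 + |(k : ℝ)|)) := by positivity
  rw [div_le_div_iff₀ hbpos hc, one_mul]
  calc c = (c / logPlus (|classicalLocationZ j| + |classicalLocationZ k|)) *
        logPlus (|classicalLocationZ j| + |classicalLocationZ k|) := by field_simp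
    _ ≤ |classicalLocationZ k - classicalLocationZ j| *
        ((1 + Bξ) * ((2 + |(j : ℝ)|) * (2 + |(k : ℝ)|))) :=
        mul_le_mul h2 h3 hL0.le hbpos.le
    _ = (1 + Bξ) * ((2 + |(j : ℝ)|) * (2 + |(k : ℝ)|)) * |classicalLocationZ k - classicalLocationZ j| := by
        ring

/-- `u_j + u_k ≤ u_j u_k` for `u_j, u_k ≥ 2`. [folklore] -/
private theorem add_le_mul_of_two_le {x y : ℝ} (hx : 2 ≤ x) (hy : 2 ≤ y) : x + y ≤ x * y := by
  nlinarith

/-- **The `t`-free pieces are polynomially bounded**: under the location law on `[t₁, t₂]`,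
`8/(ξ_k − ξ_j)² + 2|x_k(t) − x_j(t)|/|ξ_k − ξ_j|³ ≤ K (2 + |j|)⁴ (2 + |k|)⁴` for distinct
`j, k ∈ ℤ*` and `t ∈ [t₁, t₂]` ((43), (44) lower half, (50)).
[cite: RodgersTaoFMP2020, Lemma 8 (43)–(44) p. 21; Corollary 10 (50) p. 23] -/
theorem exists_tfree_bound {t₁ t₂ B : ℝ}
    (H2 : ∀ t ∈ Icc t₁ t₂, ∀ n : ℕ, 1 ≤ n →
      |deBruijnZero t n - classicalLocation (n : ℝ)| ≤ B * logPlus (classicalLocation (n : ℝ))) :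
    ∃ K : ℝ, 0 ≤ K ∧ ∀ t ∈ Icc t₁ t₂, ∀ j k : ℤ, j ≠ 0 → k ≠ 0 → j ≠ k →
      8 / (classicalLocationZ k - classicalLocationZ j) ^ 2
        + 2 * |deBruijnZeroZ t k - deBruijnZeroZ t j| / |classicalLocationZ k - classicalLocationZ j| ^ 3
        ≤ K * ((2 + |(j : ℝ)|) ^ 4 * (2 + |(k : ℝ)|) ^ 4) := by
  obtain ⟨c, C, Bξ, c₈, C₈, A, hc, -, hBξ, -, -, -, h44, h43, h8, -⟩ :=
    RodgersTaoTruncEnergyExpansion.exists_constants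
  set K₁ : ℝ := (1 + Bξ) / c with hK₁
  set K₂ : ℝ := Bξ + max B 0 * C₈ with hK₂
  have hK₁0 : 0 < K₁ := by positivity
  have hC₈ : 0 ≤ C₈ := by
    have h := (h8 1 le_rfl).2
    have h0 : 0 < logPlus (1 : ℝ) := logPlus_pos _
    have h1' : 0 ≤ logPlus (classicalLocation 1) := logPlus_nonneg _
    nlinarith
  have hK₂0 : 0 ≤ K₂ := by positivity
  refine ⟨8 * K₁ ^ 2 + 2 * K₂ * K₁ ^ 3, by positivity, fun t ht j k hj hk hjk ↦ ?_⟩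
  set uj : ℝ := 2 + |(j : ℝ)| with huj
  set uk : ℝ := 2 + |(k : ℝ)| with huk
  set P : ℝ := uj * uk with hP
  have huj2 : 2 ≤ uj := by have := abs_nonneg (j : ℝ); linarith
  have huk2 : 2 ≤ uk := by have := abs_nonneg (k : ℝ); linarith
  have hP1 : 1 ≤ P := by nlinarith
  have hP0 : 0 ≤ P := by linarith
  -- `1/|b| ≤ K₁ P`
  have hinv : 1 / |classicalLocationZ k - classicalLocationZ j| ≤ K₁ * P := by
    have := inv_abs_sub_le hc hBξ (fun j k hj hk ↦ (h44 j k hj hk).1) h43 hj hk hjk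
    rw [hK₁, hP, huj, huk]
    calc 1 / |classicalLocationZ k - classicalLocationZ j|
        ≤ (1 + Bξ) * ((2 + |(j : ℝ)|) * (2 + |(k : ℝ)|)) / c := this
      _ = (1 + Bξ) / c * ((2 + |(j : ℝ)|) * (2 + |(k : ℝ)|)) := by ring
  have hb0 : classicalLocationZ k - classicalLocationZ j ≠ 0 := classicalLocationZ_sub_ne_zero hjk
  have hbpos : 0 < |classicalLocationZ k - classicalLocationZ j| := abs_pos.2 hb0
  have hinv0 : 0 ≤ 1 / |classicalLocationZ k - classicalLocationZ j| := by positivity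
  -- `|a| ≤ K₂ P`
  have hxj := abs_deBruijnZeroZ_le h43 h8 (H2 t ht) j
  have hxk := abs_deBruijnZeroZ_le h43 h8 (H2 t ht) k
  have hXj : Bξ * |(j : ℝ)| + max B 0 * C₈ * logPlus j ≤ K₂ * uj := by
    have h1 : |(j : ℝ)| ≤ uj := by rw [huj]; linarith
    have h2 : logPlus (j : ℝ) ≤ uj := logPlus_le_two_add_abs _
    have h3 : 0 ≤ max B 0 * C₈ := by positivity
    rw [hK₂]
    nlinarith [mul_le_mul_of_nonneg_left h1 hBξ.le, mul_le_mul_of_nonneg_left h2 h3]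
  have hXk : Bξ * |(k : ℝ)| + max B 0 * C₈ * logPlus k ≤ K₂ * uk := by
    have h1 : |(k : ℝ)| ≤ uk := by rw [huk]; linarith
    have h2 : logPlus (k : ℝ) ≤ uk := logPlus_le_two_add_abs _
    have h3 : 0 ≤ max B 0 * C₈ := by positivity
    rw [hK₂]
    nlinarith [mul_le_mul_of_nonneg_left h1 hBξ.le, mul_le_mul_of_nonneg_left h2 h3]
  have ha : |deBruijnZeroZ t k - deBruijnZeroZ t j| ≤ K₂ * P := by
    have h1 : |deBruijnZeroZ t k - deBruijnZeroZ t j| ≤ |deBruijnZeroZ t k| + |deBruijnZeroZ t j| :=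
      abs_sub _ _
    have h2 : K₂ * uk + K₂ * uj ≤ K₂ * P := by
      rw [← mul_add, hP]
      exact mul_le_mul_of_nonneg_left (by rw [add_comm]; exact add_le_mul_of_two_le huj2 huk2) hK₂0
    linarith
  have ha0 : 0 ≤ |deBruijnZeroZ t k - deBruijnZeroZ t j| := abs_nonneg _
  -- first piece
  have hpiece1 : 8 / (classicalLocationZ k - classicalLocationZ j) ^ 2 ≤ 8 * (K₁ * P) ^ 2 := by
    have : 8 / (classicalLocationZ k - classicalLocationZ j) ^ 2 =
        8 * (1 / |classicalLocationZ k - classicalLocationZ j|) ^ 2 := by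
      rw [← sq_abs, div_pow, one_pow, mul_one_div]
    rw [this]
    exact mul_le_mul_of_nonneg_left (pow_le_pow_left₀ hinv0 hinv 2) (by norm_num)
  -- second piece
  have hpiece2 : 2 * |deBruijnZeroZ t k - deBruijnZeroZ t j| / |classicalLocationZ k - classicalLocationZ j| ^ 3
      ≤ 2 * (K₂ * P) * (K₁ * P) ^ 3 := by
    have : 2 * |deBruijnZeroZ t k - deBruijnZeroZ t j| / |classicalLocationZ k - classicalLocationZ j| ^ 3 =
        2 * |deBruijnZeroZ t k - deBruijnZeroZ t j| * (1 / |classicalLocationZ k - classicalLocationZ j|) ^ 3 := by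
      rw [div_pow, one_pow, mul_one_div]
    rw [this]
    exact mul_le_mul (mul_le_mul_of_nonneg_left ha (by norm_num)) (pow_le_pow_left₀ hinv0 hinv 3)
      (by positivity) (by positivity)
  have hP24 : P ^ 2 ≤ P ^ 4 := pow_le_pow_right₀ hP1 (by norm_num)
  calc 8 / (classicalLocationZ k - classicalLocationZ j) ^ 2
        + 2 * |deBruijnZeroZ t k - deBruijnZeroZ t j| / |classicalLocationZ k - classicalLocationZ j| ^ 3
      ≤ 8 * (K₁ * P) ^ 2 + 2 * (K₂ * P) * (K₁ * P) ^ 3 := add_le_add hpiece1 hpiece2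
    _ = 8 * K₁ ^ 2 * P ^ 2 + 2 * K₂ * K₁ ^ 3 * P ^ 4 := by ring
    _ ≤ 8 * K₁ ^ 2 * P ^ 4 + 2 * K₂ * K₁ ^ 3 * P ^ 4 := by
        have : 0 ≤ 8 * K₁ ^ 2 := by positivity
        nlinarith
    _ = (8 * K₁ ^ 2 + 2 * K₂ * K₁ ^ 3) * ((2 + |(j : ℝ)|) ^ 4 * (2 + |(k : ℝ)|) ^ 4) := by
        rw [hP, huj, huk]; ring

/-! ### Continuity in `t` (measurability of the summands) -/

/-- `t ↦ Ẽ_{jk}(t)` is continuous at every `t > Λ` (`j ≠ k`).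
[cite: RodgersTaoFMP2020, §7 p. 40 (definition of Ẽ_jk); Thm. 11 p. 27] -/
theorem continuousAt_renormEnergyZ {t : ℝ} (hΛ : ∃ t₁ : ℝ, t₁ < t ∧ HasOnlyRealZeros (deBruijnH t₁))
    {j k : ℤ} (hjk : j ≠ k) : ContinuousAt (fun s ↦ renormEnergyZ s j k) t := by
  have e : (fun s ↦ renormEnergyZ s j k) = fun s ↦
      renormPotential ((deBruijnZeroZ s k - deBruijnZeroZ s j) /
        (classicalLocationZ k - classicalLocationZ j)) / (classicalLocationZ k - classicalLocationZ j) ^ 2 := by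
    funext s; exact renormEnergyZ_eq s j k
  rw [e]
  have hb0 : classicalLocationZ k - classicalLocationZ j ≠ 0 := classicalLocationZ_sub_ne_zero hjk
  have hx0 : (deBruijnZeroZ t k - deBruijnZeroZ t j) / (classicalLocationZ k - classicalLocationZ j) ≠ 0 :=
    div_ne_zero (deBruijnZeroZ_sub_ne_zero hΛ hjk) hb0
  have hinner : ContinuousAt (fun s ↦ (deBruijnZeroZ s k - deBruijnZeroZ s j) /
      (classicalLocationZ k - classicalLocationZ j)) t :=
    ((continuousAt_deBruijnZeroZ hΛ k).sub (continuousAt_deBruijnZeroZ hΛ j)).div_const _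
  exact ((continuousAt_renormPotential hx0).comp (f := fun s ↦ (deBruijnZeroZ s k - deBruijnZeroZ s j) /
      (classicalLocationZ k - classicalLocationZ j)) (x := t) hinner).div_const _

/-- `t ↦ ψ_T(j) ψ_T(k) Ẽ_{jk}(t)` is continuous on `[t₁, t₂]` (`Λ < t₁`).
[cite: RodgersTaoFMP2020, §7 p. 42 (67)] -/
theorem continuousOn_truncEnergyTerm {t₀ t₁ t₂ : ℝ} (hreal : HasOnlyRealZeros (deBruijnH t₀))
    (ht₀ : t₀ < t₁) (T : ℝ) (p : zstarOffDiag) :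
    ContinuousOn (fun t ↦ truncEnergyTerm T t p) (Icc t₁ t₂) := by
  intro t ht
  have hΛ : ∃ t₁' : ℝ, t₁' < t ∧ HasOnlyRealZeros (deBruijnH t₁') := ⟨t₀, by linarith [ht.1], hreal⟩
  have e : (fun t ↦ truncEnergyTerm T t p) =
      fun t ↦ truncWeight T p.1.1 * truncWeight T p.1.2 * renormEnergyZ t p.1.1 p.1.2 := by
    funext s; exact truncEnergyTerm_eq T s p
  rw [e]
  exact (continuousAt_const.mul (continuousAt_renormEnergyZ hΛ p.2.2.2)).continuousWithinAt

/-- Measurability of `t ↦ ψ_T(j) ψ_T(k) Ẽ_{jk}(t)` on `[t₁, t₂]` (as an `ℝ≥0∞`-valued function).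
[cite: RodgersTaoFMP2020, §7 p. 42 (67)] -/
theorem aemeasurable_truncEnergyTerm {t₀ t₁ t₂ : ℝ} (hreal : HasOnlyRealZeros (deBruijnH t₀))
    (ht₀ : t₀ < t₁) (T : ℝ) (p : zstarOffDiag) :
    AEMeasurable (fun t ↦ ENNReal.ofReal (truncEnergyTerm T t p)) (volume.restrict (Icc t₁ t₂)) :=
  ((continuousOn_truncEnergyTerm hreal ht₀ T p (t₂ := t₂)).aemeasurable
    measurableSet_Icc).ennreal_ofReal

/-- `t ↦ E_{jk}(t)` is continuous on `[t₁, t₂]` (`Λ < t₁`; for `j = k` it is the constant `0`).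
[cite: RodgersTaoFMP2020, §4 p. 29 (58)] -/
theorem continuousOn_interactionEnergy {t₀ t₁ t₂ : ℝ} (hreal : HasOnlyRealZeros (deBruijnH t₀))
    (ht₀ : t₀ < t₁) (j k : ℤ) :
    ContinuousOn (fun t ↦ interactionEnergy t j k) (Icc t₁ t₂) := by
  rcases eq_or_ne j k with rfl | hjk
  · have : (fun t ↦ interactionEnergy t j j) = fun _ ↦ (0 : ℝ) := by
      funext t; simp [interactionEnergy_eq]
    rw [this]; exact continuousOn_const
  intro t ht
  have hΛ : ∃ t₁' : ℝ, t₁' < t ∧ HasOnlyRealZeros (deBruijnH t₁') := ⟨t₀, by linarith [ht.1], hreal⟩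
  exact (continuousAt_interactionEnergy hΛ hjk).continuousWithinAt

/-- Measurability of `t ↦ E_{jk}(t)` on `[t₁, t₂]` (as an `ℝ≥0∞`-valued function).
[cite: RodgersTaoFMP2020, §4 p. 29 (58)] -/
theorem aemeasurable_interactionEnergy {t₀ t₁ t₂ : ℝ} (hreal : HasOnlyRealZeros (deBruijnH t₀))
    (ht₀ : t₀ < t₁) (j k : ℤ) :
    AEMeasurable (fun t ↦ ENNReal.ofReal (interactionEnergy t j k)) (volume.restrict (Icc t₁ t₂)) :=
  ((continuousOn_interactionEnergy hreal ht₀ j k (t₂ := t₂)).aemeasurable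
    measurableSet_Icc).ennreal_ofReal

/-- Measurability of `t ↦ c·E_{jk}(t)` on `[t₁, t₂]` (as an `ℝ≥0∞`-valued function).
[cite: RodgersTaoFMP2020, §4 p. 29 (58)] -/
theorem aemeasurable_const_mul_interactionEnergy {t₀ t₁ t₂ : ℝ}
    (hreal : HasOnlyRealZeros (deBruijnH t₀)) (ht₀ : t₀ < t₁) (c : ℝ) (j k : ℤ) :
    AEMeasurable (fun t ↦ ENNReal.ofReal (c * interactionEnergy t j k)) (volume.restrict (Icc t₁ t₂)) :=
  ((continuousOn_const.mul (continuousOn_interactionEnergy hreal ht₀ j k (t₂ := t₂))).aemeasurable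
    measurableSet_Icc).ennreal_ofReal

/-! ### Far pairs (Proposition 15's far field): uniformly bounded partial sums -/

/-- The far-field bound `exists_far_interactionEnergy_sum_le` at a single far index, with the roles
of the indices swapped and reflected through `j ↦ −j`: for `|j| ≥ 2`, `k ∈ ℤ*` and
`|j − k| ≥ ⌈D log₊² j⌉`, `E_{jk}(t) ≤ C` on `[t₁, t₂]`.
[cite: RodgersTaoFMP2020, Proposition 15 proof p. 39] -/
theorem interactionEnergy_le_of_far {t₁ t₂ C D : ℝ}
    (hfar : ∀ t ∈ Icc t₁ t₂, ∀ (M L : ℕ) (k : ℤ), 2 ≤ k → k ≤ M →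
      D * logPlus (M : ℝ) ^ 2 ≤ L → ∀ S : Finset ℤ, (∀ j ∈ S, j ≠ 0 ∧ (L : ℤ) ≤ |k - j|) →
        ∑ j ∈ S, interactionEnergy t j k ≤ C)
    {t : ℝ} (ht : t ∈ Icc t₁ t₂) {j k : ℤ} (hk : k ≠ 0) (hj : 2 ≤ |j|)
    (hL : ((⌈D * logPlus (j : ℝ) ^ 2⌉₊ : ℕ) : ℤ) ≤ |j - k|) :
    interactionEnergy t j k ≤ C := by
  have pos : ∀ j k : ℤ, k ≠ 0 → 2 ≤ j → ((⌈D * logPlus (j : ℝ) ^ 2⌉₊ : ℕ) : ℤ) ≤ |j - k| →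
      interactionEnergy t j k ≤ C := by
    intro j k hk hj hL
    have hM : (j.toNat : ℤ) = j := Int.toNat_of_nonneg (by omega)
    have hMr : ((j.toNat : ℕ) : ℝ) = (j : ℝ) := by exact_mod_cast hM
    have h := hfar t ht j.toNat ⌈D * logPlus (j : ℝ) ^ 2⌉₊ j hj (by omega)
      (by rw [hMr]; exact Nat.le_ceil _) {k} (by
        intro x hx
        rw [Finset.mem_singleton] at hx
        subst hx
        exact ⟨hk, hL⟩)
    rw [Finset.sum_singleton] at h
    rwa [interactionEnergy_comm]
  rcases le_or_gt 0 j with hj0 | hj0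
  · exact pos j k hk (by rwa [abs_of_nonneg hj0] at hj) hL
  · have hj' : 2 ≤ -j := by rwa [abs_of_neg hj0] at hj
    have h := pos (-j) (-k) (neg_ne_zero.2 hk) hj' (by
      rw [Int.cast_neg, logPlus_neg]
      have : -j - -k = -(j - k) := by ring
      rwa [this, abs_neg])
    rwa [interactionEnergy_neg_neg] at h

/-- **Far part of a row.** For `k ≥ 2` and every `t ∈ [t₁, t₂]`, the `ℝ≥0∞`-sum of `E_{jk}(t)` over
the far indices `j ∈ ℤ*`, `|k − j| ≥ ⌈D log₊² k⌉`, is at most `C` (every finite partial sum is,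
by `exists_far_interactionEnergy_sum_le`). [cite: RodgersTaoFMP2020, Proposition 15 proof p. 39] -/
theorem tsum_indicator_far_le {t₁ t₂ C D : ℝ}
    (hfar : ∀ t ∈ Icc t₁ t₂, ∀ (M L : ℕ) (k : ℤ), 2 ≤ k → k ≤ M →
      D * logPlus (M : ℝ) ^ 2 ≤ L → ∀ S : Finset ℤ, (∀ j ∈ S, j ≠ 0 ∧ (L : ℤ) ≤ |k - j|) →
        ∑ j ∈ S, interactionEnergy t j k ≤ C)
    {t : ℝ} (ht : t ∈ Icc t₁ t₂) {k : ℤ} (hk : 2 ≤ k) :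
    ∑' j : ℤ, {j : ℤ | j ≠ 0 ∧ ((⌈D * logPlus (k : ℝ) ^ 2⌉₊ : ℕ) : ℤ) ≤ |k - j|}.indicator
        (fun j ↦ ENNReal.ofReal (interactionEnergy t j k)) j ≤ ENNReal.ofReal C := by
  classical
  refine ENNReal.summable.tsum_le_of_sum_le fun s ↦ ?_
  have hM : (k.toNat : ℤ) = k := Int.toNat_of_nonneg (by omega)
  have hMr : ((k.toNat : ℕ) : ℝ) = (k : ℝ) := by exact_mod_cast hM
  set L : ℕ := ⌈D * logPlus (k : ℝ) ^ 2⌉₊ with hL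
  have h := hfar t ht k.toNat L k hk (by omega) (by rw [hMr]; exact Nat.le_ceil _)
    (s.filter (fun j ↦ j ≠ 0 ∧ (L : ℤ) ≤ |k - j|)) (fun j hj ↦ (Finset.mem_filter.1 hj).2)
  have hnn : ∀ j ∈ s.filter (fun j ↦ j ≠ 0 ∧ (L : ℤ) ≤ |k - j|), 0 ≤ interactionEnergy t j k :=
    fun j _ ↦ interactionEnergy_nonneg t j k
  calc ∑ j ∈ s, {j : ℤ | j ≠ 0 ∧ (L : ℤ) ≤ |k - j|}.indicator
          (fun j ↦ ENNReal.ofReal (interactionEnergy t j k)) j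
      = ∑ j ∈ s.filter (fun j ↦ j ≠ 0 ∧ (L : ℤ) ≤ |k - j|), ENNReal.ofReal (interactionEnergy t j k) := by
        rw [Finset.sum_filter]
        refine Finset.sum_congr rfl fun j _ ↦ ?_
        simp only [Set.indicator_apply, Set.mem_setOf_eq]
    _ = ENNReal.ofReal (∑ j ∈ s.filter (fun j ↦ j ≠ 0 ∧ (L : ℤ) ≤ |k - j|), interactionEnergy t j k) :=
        (ENNReal.ofReal_sum_of_nonneg hnn).symm
    _ ≤ ENNReal.ofReal C := ENNReal.ofReal_le_ofReal h

/-! ### Near pairs of a big row sit inside one block `[⌈k/2⌉, ⌊3k/2⌋]_{ℤ*}` -/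

/-- A row sum over near indices is dominated by the full block sum of Proposition 15.
[cite: RodgersTaoFMP2020, Proposition 15 p. 38] -/
theorem sum_near_le_sum_offDiag (t : ℝ) {k : ℤ} {NEAR BLK : Finset ℤ} (hsub : NEAR ⊆ BLK)
    (hk : k ∈ BLK) (hne : ∀ j ∈ NEAR, j ≠ k) :
    ∑ j ∈ NEAR, interactionEnergy t j k ≤ ∑ p ∈ BLK.offDiag, interactionEnergy t p.1 p.2 := by
  classical
  let e : ℤ ↪ ℤ × ℤ := ⟨fun j ↦ (j, k), fun a b h ↦ by simpa using congrArg Prod.fst h⟩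
  have h1 : ∑ j ∈ NEAR, interactionEnergy t j k = ∑ p ∈ NEAR.map e, interactionEnergy t p.1 p.2 := by
    rw [Finset.sum_map]; rfl
  rw [h1]
  refine Finset.sum_le_sum_of_subset_of_nonneg (fun p hp ↦ ?_) fun p _ _ ↦ interactionEnergy_nonneg _ _ _
  obtain ⟨j, hj, rfl⟩ := Finset.mem_map.1 hp
  exact Finset.mem_offDiag.2 ⟨hsub hj, hk, hne j hj⟩

/-- **Row bound for the big rows** `k ≥ K₀` (`2⌈D log₊² k⌉ ≤ k`): with `ψ_T(j) ≤ 1`,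
`Σ_{j ∈ ℤ*, j ≠ k} ∫_{t₁}^{t₂} ψ_T(j)ψ_T(k) E_{jk} ≤ ψ_T(k) (C (t₂ − t₁) + M₀ (k/2)² log₊(k/2)^α)`:
the far indices by `tsum_indicator_far_le`, the near ones inside the block `[⌈k/2⌉, ⌊3k/2⌋]_{ℤ*}` by
`rodgers_tao_weak_energy_bound_block_of` (`κ = 3`, `J = k/2`).
[cite: RodgersTaoFMP2020, Proposition 15 pp. 38–39; Lemma 18 p. 42] -/
theorem row_le_of_big {t₀ t₁ t₂ C D M₀ T : ℝ} {α K₀ : ℕ}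
    (hreal : HasOnlyRealZeros (deBruijnH t₀)) (ht₀ : t₀ < t₁) (h12 : t₁ < t₂)
    (hT : 0 < T * Real.log T) (hC : 0 ≤ C) (hM₀ : 0 ≤ M₀)
    (hfar : ∀ t ∈ Icc t₁ t₂, ∀ (M L : ℕ) (k : ℤ), 2 ≤ k → k ≤ M →
      D * logPlus (M : ℝ) ^ 2 ≤ L → ∀ S : Finset ℤ, (∀ j ∈ S, j ≠ 0 ∧ (L : ℤ) ≤ |k - j|) →
        ∑ j ∈ S, interactionEnergy t j k ≤ C)
    (hblk : ∀ J : ℝ, 1 ≤ J →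
      ∫ t in t₁..t₂, ∑ p ∈ (zstarIcc ⌈J⌉ ⌊3 * J⌋).offDiag, interactionEnergy t p.1 p.2 ≤
        M₀ * J ^ 2 * logPlus J ^ α)
    (hK₀2 : 2 ≤ K₀)
    (hK₀ : ∀ n : ℕ, K₀ ≤ n → 2 * ((⌈D * logPlus (n : ℝ) ^ 2⌉₊ : ℕ) : ℝ) ≤ n)
    {k : ℤ} (hk : (K₀ : ℤ) ≤ k) :
    ∑' j : ℤ, zstarOffDiag.indicator (fun q : ℤ × ℤ ↦ ∫⁻ t in Icc t₁ t₂,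
        ENNReal.ofReal (truncWeight T q.1 * truncWeight T q.2 * interactionEnergy t q.1 q.2)) (j, k)
      ≤ ENNReal.ofReal (truncWeight T k *
          (C * (t₂ - t₁) + M₀ * ((k : ℝ) / 2) ^ 2 * logPlus ((k : ℝ) / 2) ^ α)) := by
  classical
  have hk2 : 2 ≤ k := le_trans (by exact_mod_cast hK₀2) hk
  have hk0 : 0 < k := by omega
  have hkr : (0 : ℝ) < k := by exact_mod_cast hk0
  set L : ℕ := ⌈D * logPlus (k : ℝ) ^ 2⌉₊ with hL
  have h2L : 2 * (L : ℝ) ≤ k := by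
    have hM : (k.toNat : ℤ) = k := Int.toNat_of_nonneg hk0.le
    have hMr : ((k.toNat : ℕ) : ℝ) = (k : ℝ) := by exact_mod_cast hM
    have := hK₀ k.toNat (by omega)
    rwa [hMr] at this
  set ψk : ℝ := truncWeight T k with hψk
  have hψk0 : 0 ≤ ψk := (truncWeight_pos hT k).le
  set FAR : Set ℤ := {j : ℤ | j ≠ 0 ∧ (L : ℤ) ≤ |k - j|} with hFAR
  set NEAR : Finset ℤ := (Finset.Icc (k - L) (k + L)).filter (fun j ↦ j ≠ 0 ∧ j ≠ k ∧ |k - j| < L)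
    with hNEAR
  set f : ℤ → ℝ → ℝ≥0∞ := fun j t ↦ ENNReal.ofReal (ψk * interactionEnergy t j k) with hf
  have hfmeas : ∀ j, AEMeasurable (f j) (volume.restrict (Icc t₁ t₂)) := fun j ↦
    aemeasurable_const_mul_interactionEnergy hreal ht₀ ψk j k
  -- pointwise split of the row into far and near indices
  have hsplit : ∀ j : ℤ, zstarOffDiag.indicator (fun q : ℤ × ℤ ↦ ∫⁻ t in Icc t₁ t₂,
      ENNReal.ofReal (truncWeight T q.1 * truncWeight T q.2 * interactionEnergy t q.1 q.2)) (j, k) ≤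
      (∫⁻ t in Icc t₁ t₂, FAR.indicator (fun j ↦ f j t) j) +
        (NEAR : Set ℤ).indicator (fun j ↦ ∫⁻ t in Icc t₁ t₂, f j t) j := by
    intro j
    by_cases hq : (j, k) ∈ zstarOffDiag
    · rw [Set.indicator_of_mem hq]
      obtain ⟨hj0, -, hjk⟩ := (mem_zstarOffDiag.1 hq)
      have hle : ∫⁻ t in Icc t₁ t₂, ENNReal.ofReal (truncWeight T j * truncWeight T k *
          interactionEnergy t j k) ≤ ∫⁻ t in Icc t₁ t₂, f j t := by
        refine lintegral_mono fun t ↦ ENNReal.ofReal_le_ofReal ?_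
        have h1 : truncWeight T j ≤ 1 := truncWeight_le_one hT j
        have h2 : 0 ≤ ψk * interactionEnergy t j k := mul_nonneg hψk0 (interactionEnergy_nonneg _ _ _)
        calc truncWeight T j * truncWeight T k * interactionEnergy t j k
            = truncWeight T j * (ψk * interactionEnergy t j k) := by rw [hψk]; ring
          _ ≤ 1 * (ψk * interactionEnergy t j k) := mul_le_mul_of_nonneg_right h1 h2
          _ = ψk * interactionEnergy t j k := one_mul _
      by_cases hfarj : (L : ℤ) ≤ |k - j|
      · have hmem : j ∈ FAR := ⟨hj0, hfarj⟩
        have : ∫⁻ t in Icc t₁ t₂, f j t = ∫⁻ t in Icc t₁ t₂, FAR.indicator (fun j ↦ f j t) j := by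
          simp only [Set.indicator_of_mem hmem]
        calc _ ≤ ∫⁻ t in Icc t₁ t₂, f j t := hle
          _ = _ := this
          _ ≤ _ := le_self_add
      · have hmem : j ∈ NEAR := by
          rw [hNEAR, Finset.mem_filter, Finset.mem_Icc]
          have h' : |k - j| < (L : ℤ) := lt_of_not_ge hfarj
          refine ⟨⟨?_, ?_⟩, hj0, hjk, h'⟩
          · have := (abs_lt.1 h').2; omega
          · have := (abs_lt.1 h').1; omega
        have hmem' : j ∈ (NEAR : Set ℤ) := by exact_mod_cast hmem
        rw [Set.indicator_of_mem hmem']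
        exact hle.trans le_add_self
    · rw [Set.indicator_of_notMem hq]
      exact zero_le
  -- the far part
  have hfarI : ∑' j : ℤ, ∫⁻ t in Icc t₁ t₂, FAR.indicator (fun j ↦ f j t) j ≤
      ENNReal.ofReal (ψk * (C * (t₂ - t₁))) := by
    have hmeas' : ∀ j, AEMeasurable (fun t ↦ FAR.indicator (fun j ↦ f j t) j)
        (volume.restrict (Icc t₁ t₂)) := by
      intro j
      by_cases hj : j ∈ FAR
      · simp only [Set.indicator_of_mem hj]; exact hfmeas j
      · simp only [Set.indicator_of_notMem hj]; exact aemeasurable_const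
    rw [← lintegral_tsum hmeas']
    have hpt : ∀ᵐ t ∂(volume.restrict (Icc t₁ t₂)),
        (∑' j : ℤ, FAR.indicator (fun j ↦ f j t) j) ≤ ENNReal.ofReal ψk * ENNReal.ofReal C := by
      filter_upwards [ae_restrict_mem measurableSet_Icc] with t ht
      have h1 : (fun j ↦ FAR.indicator (fun j ↦ f j t) j) =
          fun j ↦ ENNReal.ofReal ψk * FAR.indicator (fun j ↦ ENNReal.ofReal (interactionEnergy t j k)) j := by
        funext j
        rw [hf]
        simp only [ENNReal.ofReal_mul hψk0]
        rw [Set.indicator_mul_right FAR (fun _ ↦ ENNReal.ofReal ψk)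
          (fun j ↦ ENNReal.ofReal (interactionEnergy t j k))]
      rw [h1, ENNReal.tsum_mul_left]
      gcongr
      exact tsum_indicator_far_le hfar ht hk2
    calc ∫⁻ t in Icc t₁ t₂, ∑' j : ℤ, FAR.indicator (fun j ↦ f j t) j
        ≤ ∫⁻ _ in Icc t₁ t₂, ENNReal.ofReal ψk * ENNReal.ofReal C := lintegral_mono_ae hpt
      _ = ENNReal.ofReal ψk * ENNReal.ofReal C * volume (Icc t₁ t₂) := setLIntegral_const _ _
      _ = ENNReal.ofReal (ψk * (C * (t₂ - t₁))) := by
          rw [Real.volume_Icc, ← ENNReal.ofReal_mul hψk0, ← ENNReal.ofReal_mul (by positivity)]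
          ring_nf
  -- the near part
  set BLK : Finset ℤ := zstarIcc ⌈(k : ℝ) / 2⌉ ⌊3 * ((k : ℝ) / 2)⌋ with hBLK
  have hNEARsub : NEAR ⊆ BLK := by
    intro j hj
    rw [hNEAR, Finset.mem_filter] at hj
    obtain ⟨-, hj0, -, hlt⟩ := hj
    have hlt' : |(k : ℝ) - j| < L := by
      have : ((|k - j| : ℤ) : ℝ) < ((L : ℤ) : ℝ) := by exact_mod_cast hlt
      simpa [Int.cast_abs, Int.cast_sub] using this
    have h1 := (abs_lt.1 hlt').1
    have h2 := (abs_lt.1 hlt').2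
    rw [hBLK, mem_zstarIcc]
    refine ⟨hj0, Int.ceil_le.2 ?_, Int.le_floor.2 ?_⟩
    · linarith
    · linarith
  have hkBLK : k ∈ BLK := by
    rw [hBLK, mem_zstarIcc]
    refine ⟨by omega, Int.ceil_le.2 ?_, Int.le_floor.2 ?_⟩
    · linarith
    · linarith
  have hNEARne : ∀ j ∈ NEAR, j ≠ k := by
    intro j hj
    rw [hNEAR, Finset.mem_filter] at hj
    exact hj.2.2.1
  have hJ : (1 : ℝ) ≤ (k : ℝ) / 2 := by
    have : (2 : ℝ) ≤ k := by exact_mod_cast hk2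
    linarith
  have hnearI : ∑' j : ℤ, (NEAR : Set ℤ).indicator (fun j ↦ ∫⁻ t in Icc t₁ t₂, f j t) j ≤
      ENNReal.ofReal (ψk * (M₀ * ((k : ℝ) / 2) ^ 2 * logPlus ((k : ℝ) / 2) ^ α)) := by
    rw [← sum_eq_tsum_indicator, ← lintegral_finsetSum' _ (fun j _ ↦ hfmeas j)]
    -- continuity / integrability of the block sum
    have hcont : ContinuousOn (fun t ↦ ψk * ∑ p ∈ BLK.offDiag, interactionEnergy t p.1 p.2) (Icc t₁ t₂) :=
      continuousOn_const.mul (continuousOn_sum_offDiag_interactionEnergy hreal ht₀ BLK)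
    have hint : Integrable (fun t ↦ ψk * ∑ p ∈ BLK.offDiag, interactionEnergy t p.1 p.2)
        (volume.restrict (Icc t₁ t₂)) := hcont.integrableOn_Icc
    have hnn : 0 ≤ᵐ[volume.restrict (Icc t₁ t₂)]
        (fun t ↦ ψk * ∑ p ∈ BLK.offDiag, interactionEnergy t p.1 p.2) :=
      Filter.Eventually.of_forall fun t ↦ mul_nonneg hψk0
        (Finset.sum_nonneg fun p _ ↦ interactionEnergy_nonneg _ _ _)
    have hpt : ∀ t, (∑ j ∈ NEAR, f j t) ≤
        ENNReal.ofReal (ψk * ∑ p ∈ BLK.offDiag, interactionEnergy t p.1 p.2) := by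
      intro t
      rw [hf]
      simp only
      rw [← ENNReal.ofReal_sum_of_nonneg (fun j _ ↦ mul_nonneg hψk0 (interactionEnergy_nonneg _ _ _)),
        ← Finset.mul_sum]
      exact ENNReal.ofReal_le_ofReal (mul_le_mul_of_nonneg_left
        (sum_near_le_sum_offDiag t hNEARsub hkBLK hNEARne) hψk0)
    have hIcc : ∫ t in Icc t₁ t₂, ∑ p ∈ BLK.offDiag, interactionEnergy t p.1 p.2 =
        ∫ t in t₁..t₂, ∑ p ∈ BLK.offDiag, interactionEnergy t p.1 p.2 := by
      rw [intervalIntegral.integral_of_le h12.le, integral_Icc_eq_integral_Ioc]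
    calc ∫⁻ t in Icc t₁ t₂, ∑ j ∈ NEAR, f j t
        ≤ ∫⁻ t in Icc t₁ t₂, ENNReal.ofReal (ψk * ∑ p ∈ BLK.offDiag, interactionEnergy t p.1 p.2) :=
          lintegral_mono hpt
      _ = ENNReal.ofReal (∫ t in Icc t₁ t₂, ψk * ∑ p ∈ BLK.offDiag, interactionEnergy t p.1 p.2) :=
          (ofReal_integral_eq_lintegral_ofReal hint hnn).symm
      _ ≤ ENNReal.ofReal (ψk * (M₀ * ((k : ℝ) / 2) ^ 2 * logPlus ((k : ℝ) / 2) ^ α)) := by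
          refine ENNReal.ofReal_le_ofReal ?_
          rw [integral_const_mul, hIcc]
          exact mul_le_mul_of_nonneg_left (by simpa [hBLK] using hblk ((k : ℝ) / 2) hJ) hψk0
  have hA0 : 0 ≤ C * (t₂ - t₁) := by nlinarith
  have hB0 : 0 ≤ M₀ * ((k : ℝ) / 2) ^ 2 * logPlus ((k : ℝ) / 2) ^ α := by
    have := logPlus_nonneg ((k : ℝ) / 2); positivity
  calc ∑' j : ℤ, zstarOffDiag.indicator (fun q : ℤ × ℤ ↦ ∫⁻ t in Icc t₁ t₂,
          ENNReal.ofReal (truncWeight T q.1 * truncWeight T q.2 * interactionEnergy t q.1 q.2)) (j, k)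
      ≤ ∑' j : ℤ, ((∫⁻ t in Icc t₁ t₂, FAR.indicator (fun j ↦ f j t) j) +
          (NEAR : Set ℤ).indicator (fun j ↦ ∫⁻ t in Icc t₁ t₂, f j t) j) := ENNReal.tsum_le_tsum hsplit
    _ = (∑' j : ℤ, ∫⁻ t in Icc t₁ t₂, FAR.indicator (fun j ↦ f j t) j) +
          ∑' j : ℤ, (NEAR : Set ℤ).indicator (fun j ↦ ∫⁻ t in Icc t₁ t₂, f j t) j := ENNReal.tsum_add
    _ ≤ ENNReal.ofReal (ψk * (C * (t₂ - t₁))) +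
          ENNReal.ofReal (ψk * (M₀ * ((k : ℝ) / 2) ^ 2 * logPlus ((k : ℝ) / 2) ^ α)) :=
        add_le_add hfarI hnearI
    _ = ENNReal.ofReal (ψk * (C * (t₂ - t₁) + M₀ * ((k : ℝ) / 2) ^ 2 * logPlus ((k : ℝ) / 2) ^ α)) := by
        rw [← ENNReal.ofReal_add (mul_nonneg hψk0 hA0) (mul_nonneg hψk0 hB0), ← mul_add]

/-- **The small rows are finite**: for `0 < |k| < K₀`, the row `Σ_j ∫ ψ_T(j)ψ_T(k) E_{jk}` is finite —
the indices `|j| ≥ 2K₀` are far from `k` (`E_{jk} ≤ C` on `[t₁, t₂]`, and `Σ_j ψ_T(j) < ∞`), the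
finitely many others have `t ↦ E_{jk}(t)` continuous on the compact interval.
[cite: RodgersTaoFMP2020, Proposition 15 proof p. 39; Lemma 18 p. 42] -/
theorem row_lt_top_of_small {t₀ t₁ t₂ C D T : ℝ} {K₀ : ℕ}
    (hreal : HasOnlyRealZeros (deBruijnH t₀)) (ht₀ : t₀ < t₁)
    (hT : 0 < T * Real.log T) (hC : 0 ≤ C)
    (hfar : ∀ t ∈ Icc t₁ t₂, ∀ (M L : ℕ) (k : ℤ), 2 ≤ k → k ≤ M →
      D * logPlus (M : ℝ) ^ 2 ≤ L → ∀ S : Finset ℤ, (∀ j ∈ S, j ≠ 0 ∧ (L : ℤ) ≤ |k - j|) →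
        ∑ j ∈ S, interactionEnergy t j k ≤ C)
    (hK₀1 : 1 ≤ K₀)
    (hK₀ : ∀ n : ℕ, K₀ ≤ n → 2 * ((⌈D * logPlus (n : ℝ) ^ 2⌉₊ : ℕ) : ℝ) ≤ n)
    {k : ℤ} (hk0 : k ≠ 0) (hk : |k| < K₀) :
    ∑' j : ℤ, zstarOffDiag.indicator (fun q : ℤ × ℤ ↦ ∫⁻ t in Icc t₁ t₂,
        ENNReal.ofReal (truncWeight T q.1 * truncWeight T q.2 * interactionEnergy t q.1 q.2)) (j, k)
      < ⊤ := by
  classical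
  set Fq : ℤ × ℤ → ℝ≥0∞ := fun q ↦ ∫⁻ t in Icc t₁ t₂,
    ENNReal.ofReal (truncWeight T q.1 * truncWeight T q.2 * interactionEnergy t q.1 q.2) with hFq
  set Bfs : Finset ℤ := Finset.Ioo (-(2 * (K₀ : ℤ))) (2 * K₀) with hBfs
  set A : ℤ → ℝ≥0∞ := fun j ↦ ENNReal.ofReal (truncWeight T j * C) * volume (Icc t₁ t₂) with hA
  have hkr : |(k : ℝ)| < K₀ := by
    have : ((|k| : ℤ) : ℝ) < ((K₀ : ℤ) : ℝ) := by exact_mod_cast hk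
    simpa [Int.cast_abs] using this
  -- pointwise split
  have hsplit : ∀ j : ℤ, zstarOffDiag.indicator Fq (j, k) ≤ A j + (Bfs : Set ℤ).indicator
      (fun j ↦ zstarOffDiag.indicator Fq (j, k)) j := by
    intro j
    by_cases hB : j ∈ Bfs
    · rw [Set.indicator_of_mem (Finset.mem_coe.2 hB)]
      exact le_add_self
    · have hB' : j ∉ (Bfs : Set ℤ) := by simpa using hB
      rw [Set.indicator_of_notMem hB', add_zero]
      have hj2 : 2 * (K₀ : ℤ) ≤ |j| := by
        rw [hBfs, Finset.mem_Ioo, not_and_or, not_lt, not_lt] at hB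
        rcases hB with h | h
        · exact le_abs.2 (Or.inr (by omega))
        · exact le_abs.2 (Or.inl h)
      by_cases hq : (j, k) ∈ zstarOffDiag
      · rw [Set.indicator_of_mem hq, hFq]
        have hjr : 2 * (K₀ : ℝ) ≤ |(j : ℝ)| := by
          have : ((2 * (K₀ : ℤ) : ℤ) : ℝ) ≤ ((|j| : ℤ) : ℝ) := by exact_mod_cast hj2
          simpa [Int.cast_abs] using this
        -- the far threshold of `j` is at most `|j|/2 ≤ |j − k|`
        have hLj : ((⌈D * logPlus (j : ℝ) ^ 2⌉₊ : ℕ) : ℤ) ≤ |j - k| := by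
          have hnat : K₀ ≤ j.natAbs := by
            have : (K₀ : ℤ) ≤ |j| := by omega
            have h' : (K₀ : ℤ) ≤ (j.natAbs : ℤ) := by rwa [Int.natCast_natAbs]
            exact_mod_cast h'
          have h1 := hK₀ j.natAbs hnat
          have hcast : ((j.natAbs : ℕ) : ℝ) = |(j : ℝ)| := by
            rw [Nat.cast_natAbs, Int.cast_abs]
          rw [hcast, logPlus_abs] at h1
          have h2 : |(j : ℝ)| - |(k : ℝ)| ≤ |(j : ℝ) - k| := abs_sub_abs_le_abs_sub _ _
          have h3 : (((⌈D * logPlus (j : ℝ) ^ 2⌉₊ : ℕ) : ℤ) : ℝ) ≤ ((|j - k| : ℤ) : ℝ) := by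
            push_cast
            linarith
          exact_mod_cast h3
        have hj2' : 2 ≤ |j| := by omega
        have hpt : ∀ᵐ t ∂(volume.restrict (Icc t₁ t₂)),
            ENNReal.ofReal (truncWeight T j * truncWeight T k * interactionEnergy t j k) ≤
              ENNReal.ofReal (truncWeight T j * C) := by
          filter_upwards [ae_restrict_mem measurableSet_Icc] with t ht
          refine ENNReal.ofReal_le_ofReal ?_
          have hE := interactionEnergy_le_of_far hfar ht hk0 hj2' hLj
          have h1 : truncWeight T k ≤ 1 := truncWeight_le_one hT k
          have hψj : 0 ≤ truncWeight T j := (truncWeight_pos hT j).le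
          have hψk : 0 ≤ truncWeight T k := (truncWeight_pos hT k).le
          have hE0 : 0 ≤ interactionEnergy t j k := interactionEnergy_nonneg _ _ _
          calc truncWeight T j * truncWeight T k * interactionEnergy t j k
              ≤ truncWeight T j * 1 * C := by
                rw [mul_assoc, mul_assoc]
                exact mul_le_mul_of_nonneg_left (mul_le_mul h1 hE hE0 zero_le_one) hψj
            _ = truncWeight T j * C := by ring
        calc ∫⁻ t in Icc t₁ t₂, ENNReal.ofReal (truncWeight T j * truncWeight T k * interactionEnergy t j k)
            ≤ ∫⁻ _ in Icc t₁ t₂, ENNReal.ofReal (truncWeight T j * C) := lintegral_mono_ae hpt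
          _ = A j := setLIntegral_const _ _
      · rw [Set.indicator_of_notMem hq]
        exact zero_le
  -- the far majorant is summable
  have hAsum : ∑' j : ℤ, A j < ⊤ := by
    rw [hA, ENNReal.tsum_mul_right]
    refine ENNReal.mul_lt_top ?_ (by rw [Real.volume_Icc]; exact ENNReal.ofReal_lt_top)
    rw [← ENNReal.ofReal_tsum_of_nonneg (fun j ↦ mul_nonneg (truncWeight_pos hT j).le hC)
      ((summable_truncWeight hT).mul_right C)]
    exact ENNReal.ofReal_lt_top
  -- the finitely many remaining summands are finite
  have hBsum : ∑' j : ℤ, (Bfs : Set ℤ).indicator (fun j ↦ zstarOffDiag.indicator Fq (j, k)) j < ⊤ := by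
    rw [← sum_eq_tsum_indicator]
    refine ENNReal.sum_lt_top.2 fun j _ ↦ ?_
    by_cases hq : (j, k) ∈ zstarOffDiag
    · rw [Set.indicator_of_mem hq, hFq]
      have hint : Integrable (fun t ↦ truncWeight T j * truncWeight T k * interactionEnergy t j k)
          (volume.restrict (Icc t₁ t₂)) :=
        (continuousOn_const.mul (continuousOn_interactionEnergy hreal ht₀ j k (t₂ := t₂))).integrableOn_Icc
      exact hint.lintegral_lt_top
    · rw [Set.indicator_of_notMem hq]
      exact ENNReal.zero_lt_top
  calc ∑' j : ℤ, zstarOffDiag.indicator Fq (j, k)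
      ≤ ∑' j : ℤ, (A j + (Bfs : Set ℤ).indicator (fun j ↦ zstarOffDiag.indicator Fq (j, k)) j) :=
        ENNReal.tsum_le_tsum hsplit
    _ = (∑' j : ℤ, A j) + ∑' j : ℤ, (Bfs : Set ℤ).indicator (fun j ↦ zstarOffDiag.indicator Fq (j, k)) j :=
        ENNReal.tsum_add
    _ < ⊤ := ENNReal.add_lt_top.2 ⟨hAsum, hBsum⟩

/-- Rows are even in `k`: `(j, k) ↦ (−j, −k)` preserves `ℤ*`-off-diagonality, `ψ_T` and `E_{jk}`.
[cite: RodgersTaoFMP2020, §1.2 p. 7 (oddness); §7 p. 42 (66)] -/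
theorem row_neg (t₁ t₂ T : ℝ) (k : ℤ) :
    ∑' j : ℤ, zstarOffDiag.indicator (fun q : ℤ × ℤ ↦ ∫⁻ t in Icc t₁ t₂,
        ENNReal.ofReal (truncWeight T q.1 * truncWeight T q.2 * interactionEnergy t q.1 q.2)) (j, -k) =
    ∑' j : ℤ, zstarOffDiag.indicator (fun q : ℤ × ℤ ↦ ∫⁻ t in Icc t₁ t₂,
        ENNReal.ofReal (truncWeight T q.1 * truncWeight T q.2 * interactionEnergy t q.1 q.2)) (j, k) := by
  set Fq : ℤ × ℤ → ℝ≥0∞ := fun q ↦ ∫⁻ t in Icc t₁ t₂,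
    ENNReal.ofReal (truncWeight T q.1 * truncWeight T q.2 * interactionEnergy t q.1 q.2) with hFq
  rw [← (Equiv.neg ℤ).tsum_eq (fun j ↦ zstarOffDiag.indicator Fq (j, -k))]
  refine tsum_congr fun j ↦ ?_
  simp only [Equiv.neg_apply]
  have hmem : ((-j, -k) ∈ zstarOffDiag) ↔ ((j, k) ∈ zstarOffDiag) := by
    simp only [mem_zstarOffDiag, ne_eq, neg_eq_zero, neg_inj]
  by_cases hq : (j, k) ∈ zstarOffDiag
  · rw [Set.indicator_of_mem hq, Set.indicator_of_mem (hmem.2 hq), hFq]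
    simp only [truncWeight_neg, interactionEnergy_neg_neg]
  · rw [Set.indicator_of_notMem hq, Set.indicator_of_notMem (mt hmem.1 hq)]

/-! ### Tonelli: the integrated truncated energy is finite -/

/-- **`∫_{t₁}^{t₂} Ẽ_T(t) dt < ∞` (as a lower Lebesgue integral of the `ℝ≥0∞`-valued series (67)).**
Termwise `Ẽ_{jk} ≤ 2E_{jk} + (t-free polynomial pieces)`; the `E`-part is summed row by row
(`row_le_of_big` for `|k| ≥ K₀`, `row_lt_top_of_small` for the finitely many other rows, rows being
even in `k`), the `t`-free part against `Σ_j ψ_T(j)(2 + |j|)⁴ < ∞`.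
[cite: RodgersTaoFMP2020, Lemma 18 p. 42 («finite for almost every Λ/2 ≤ t ≤ 0»); Proposition 15 pp. 38–39] -/
theorem lintegral_tsum_truncEnergyTerm_ne_top {t₀ t₁ t₂ B : ℝ}
    (hreal : HasOnlyRealZeros (deBruijnH t₀)) (ht₀ : t₀ < t₁) (h12 : t₁ < t₂)
    (H2 : ∀ t ∈ Icc t₁ t₂, ∀ n : ℕ, 1 ≤ n →
      |deBruijnZero t n - classicalLocation (n : ℝ)| ≤ B * logPlus (classicalLocation (n : ℝ)))
    {T : ℝ} (hT : 0 < T * Real.log T) :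
    ∫⁻ t in Icc t₁ t₂, (∑' p : zstarOffDiag, ENNReal.ofReal (truncEnergyTerm T t p)) ≠ ⊤ := by
  classical
  obtain ⟨C, D, hC, -, hfar⟩ := exists_far_interactionEnergy_sum_le (t₂ := t₂) hreal ht₀ H2
  obtain ⟨M₀, α, hM₀, hblk⟩ :=
    rodgers_tao_weak_energy_bound_block_of hreal ht₀ h12 H2 (κ := 3) (by norm_num)
  obtain ⟨K₀, hK₀2, hK₀⟩ := exists_threshold D
  obtain ⟨Kc, hKc, htf⟩ := exists_tfree_bound (t₁ := t₁) (t₂ := t₂) H2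
  obtain ⟨Cα, hCα, hlpα⟩ := exists_logPlus_pow_le α
  set V : ℝ≥0∞ := volume (Icc t₁ t₂) with hV
  have hVlt : V < ⊤ := by rw [hV, Real.volume_Icc]; exact ENNReal.ofReal_lt_top
  set Fq : ℤ × ℤ → ℝ≥0∞ := fun q ↦ ∫⁻ t in Icc t₁ t₂,
    ENNReal.ofReal (truncWeight T q.1 * truncWeight T q.2 * interactionEnergy t q.1 q.2) with hFq
  set a : ℤ → ℝ := fun j ↦ truncWeight T j * (2 + |(j : ℝ)|) ^ 4 with ha
  have ha0 : ∀ j, 0 ≤ a j := fun j ↦ mul_nonneg (truncWeight_pos hT j).le (by positivity)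
  have hasum : Summable a := summable_truncWeight_mul_pow hT (by norm_num)
  -- Step 1: termwise bound on `[t₁, t₂]`
  have hterm : ∀ p : zstarOffDiag, ∫⁻ t in Icc t₁ t₂, ENNReal.ofReal (truncEnergyTerm T t p) ≤
      2 * Fq p.1 + ENNReal.ofReal (Kc * a p.1.1 * a p.1.2) * V := by
    intro p
    obtain ⟨hj0, hk0, hjk⟩ := (mem_zstarOffDiag.1 p.2)
    have hψ : 0 ≤ truncWeight T p.1.1 * truncWeight T p.1.2 :=
      mul_nonneg (truncWeight_pos hT _).le (truncWeight_pos hT _).le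
    have hpt : ∀ᵐ t ∂(volume.restrict (Icc t₁ t₂)), ENNReal.ofReal (truncEnergyTerm T t p) ≤
        2 * ENNReal.ofReal (truncWeight T p.1.1 * truncWeight T p.1.2 * interactionEnergy t p.1.1 p.1.2)
          + ENNReal.ofReal (Kc * a p.1.1 * a p.1.2) := by
      filter_upwards [ae_restrict_mem measurableSet_Icc] with t ht
      have hΛ : ∃ t₁' : ℝ, t₁' < t ∧ HasOnlyRealZeros (deBruijnH t₁') := ⟨t₀, by linarith [ht.1], hreal⟩
      have h3 := renormEnergyZ_le_three_regimes hΛ hjk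
      have h4 := htf t ht p.1.1 p.1.2 hj0 hk0 hjk
      have hE0 : 0 ≤ interactionEnergy t p.1.1 p.1.2 := interactionEnergy_nonneg _ _ _
      have hmain : truncEnergyTerm T t p ≤
          2 * (truncWeight T p.1.1 * truncWeight T p.1.2 * interactionEnergy t p.1.1 p.1.2)
            + Kc * a p.1.1 * a p.1.2 := by
        rw [truncEnergyTerm_eq]
        calc truncWeight T p.1.1 * truncWeight T p.1.2 * renormEnergyZ t p.1.1 p.1.2
            ≤ truncWeight T p.1.1 * truncWeight T p.1.2 * (2 * interactionEnergy t p.1.1 p.1.2 +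
                Kc * ((2 + |(p.1.1 : ℝ)|) ^ 4 * (2 + |(p.1.2 : ℝ)|) ^ 4)) :=
              mul_le_mul_of_nonneg_left (by linarith) hψ
          _ = 2 * (truncWeight T p.1.1 * truncWeight T p.1.2 * interactionEnergy t p.1.1 p.1.2)
                + Kc * a p.1.1 * a p.1.2 := by rw [ha]; ring
      have h2 : (0 : ℝ) ≤ 2 * (truncWeight T p.1.1 * truncWeight T p.1.2 * interactionEnergy t p.1.1 p.1.2) :=
        by positivity
      calc ENNReal.ofReal (truncEnergyTerm T t p)
          ≤ ENNReal.ofReal (2 * (truncWeight T p.1.1 * truncWeight T p.1.2 * interactionEnergy t p.1.1 p.1.2)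
              + Kc * a p.1.1 * a p.1.2) := ENNReal.ofReal_le_ofReal hmain
        _ ≤ ENNReal.ofReal (2 * (truncWeight T p.1.1 * truncWeight T p.1.2 * interactionEnergy t p.1.1 p.1.2))
              + ENNReal.ofReal (Kc * a p.1.1 * a p.1.2) := ENNReal.ofReal_add_le
        _ = 2 * ENNReal.ofReal (truncWeight T p.1.1 * truncWeight T p.1.2 * interactionEnergy t p.1.1 p.1.2)
              + ENNReal.ofReal (Kc * a p.1.1 * a p.1.2) := by
            rw [ENNReal.ofReal_mul (by norm_num : (0:ℝ) ≤ 2), ENNReal.ofReal_ofNat]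
    calc ∫⁻ t in Icc t₁ t₂, ENNReal.ofReal (truncEnergyTerm T t p)
        ≤ ∫⁻ t in Icc t₁ t₂, (2 * ENNReal.ofReal (truncWeight T p.1.1 * truncWeight T p.1.2 *
            interactionEnergy t p.1.1 p.1.2) + ENNReal.ofReal (Kc * a p.1.1 * a p.1.2)) :=
          lintegral_mono_ae hpt
      _ = 2 * Fq p.1 + ENNReal.ofReal (Kc * a p.1.1 * a p.1.2) * V := by
          rw [lintegral_add_right _ measurable_const, lintegral_const_mul' _ _ (by norm_num),
            setLIntegral_const]
  -- Step 2: the `E`-part, row by row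
  set row : ℤ → ℝ≥0∞ := fun k ↦ ∑' j : ℤ, zstarOffDiag.indicator Fq (j, k) with hrow
  have hrows : ∑' p : zstarOffDiag, Fq p.1 = ∑' k : ℤ, row k := by
    rw [tsum_subtype zstarOffDiag Fq, ENNReal.tsum_prod', ENNReal.tsum_comm]
  set g : ℤ → ℝ := fun k ↦ truncWeight T k *
    (C * (t₂ - t₁) + M₀ * (|(k : ℝ)| / 2) ^ 2 * logPlus (|(k : ℝ)| / 2) ^ α) with hg
  have hg0 : ∀ k, 0 ≤ g k := by
    intro k
    have := logPlus_nonneg (|(k : ℝ)| / 2)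
    have : 0 ≤ C * (t₂ - t₁) := by nlinarith
    rw [hg]
    exact mul_nonneg (truncWeight_pos hT k).le (by positivity)
  have hgsum : Summable g := by
    have hbound : ∀ k, g k ≤ C * (t₂ - t₁) * truncWeight T k +
        M₀ * Cα * (truncWeight T k * (2 + |(k : ℝ)|) ^ 3) := by
      intro k
      have hψ : 0 ≤ truncWeight T k := (truncWeight_pos hT k).le
      have hk0 : 0 ≤ |(k : ℝ)| := abs_nonneg _
      have h1 : logPlus (|(k : ℝ)| / 2) ^ α ≤ Cα * (2 + |(k : ℝ)| / 2) := by
        have := hlpα (|(k : ℝ)| / 2)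
        rwa [abs_of_nonneg (by positivity : (0 : ℝ) ≤ |(k : ℝ)| / 2)] at this
      have h2 : (|(k : ℝ)| / 2) ^ 2 * logPlus (|(k : ℝ)| / 2) ^ α ≤ Cα * (2 + |(k : ℝ)|) ^ 3 := by
        have h21 : (|(k : ℝ)| / 2) ^ 2 ≤ (2 + |(k : ℝ)|) ^ 2 :=
          pow_le_pow_left₀ (by positivity) (by linarith) 2
        have h22 : Cα * (2 + |(k : ℝ)| / 2) ≤ Cα * (2 + |(k : ℝ)|) :=
          mul_le_mul_of_nonneg_left (by linarith) hCα.le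
        calc (|(k : ℝ)| / 2) ^ 2 * logPlus (|(k : ℝ)| / 2) ^ α
            ≤ (2 + |(k : ℝ)|) ^ 2 * (Cα * (2 + |(k : ℝ)|)) :=
              mul_le_mul h21 (h1.trans h22) (pow_nonneg (logPlus_nonneg _) _) (by positivity)
          _ = Cα * (2 + |(k : ℝ)|) ^ 3 := by ring
      rw [hg]
      have h3 : M₀ * (|(k : ℝ)| / 2) ^ 2 * logPlus (|(k : ℝ)| / 2) ^ α ≤ M₀ * (Cα * (2 + |(k : ℝ)|) ^ 3) := by
        rw [mul_assoc]; exact mul_le_mul_of_nonneg_left h2 hM₀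
      nlinarith [mul_le_mul_of_nonneg_left h3 hψ]
    refine Summable.of_nonneg_of_le hg0 hbound ?_
    exact ((summable_truncWeight hT).mul_left _).add
      ((summable_truncWeight_mul_pow hT (m := 3) (by norm_num)).mul_left _)
  have hbig : ∀ k : ℤ, (K₀ : ℤ) ≤ |k| → row k ≤ ENNReal.ofReal (g k) := by
    intro k hk
    rcases le_or_gt 0 k with hk0 | hk0
    · have hk' : (K₀ : ℤ) ≤ k := by rwa [abs_of_nonneg hk0] at hk
      have h := row_le_of_big (T := T) hreal ht₀ h12 hT hC hM₀ hfar hblk hK₀2 hK₀ hk'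
      have hkr : |(k : ℝ)| = k := abs_of_nonneg (by exact_mod_cast hk0)
      have hgk : ENNReal.ofReal (g k) = ENNReal.ofReal (truncWeight T k *
          (C * (t₂ - t₁) + M₀ * ((k : ℝ) / 2) ^ 2 * logPlus ((k : ℝ) / 2) ^ α)) := by
        simp only [hg, hkr]
      rw [hgk]
      simp only [hrow, hFq]
      exact h
    · have hk' : (K₀ : ℤ) ≤ -k := by rwa [abs_of_neg hk0] at hk
      have h := row_le_of_big (T := T) hreal ht₀ h12 hT hC hM₀ hfar hblk hK₀2 hK₀ hk'
      have hkr : |(k : ℝ)| = ((-k : ℤ) : ℝ) := by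
        rw [Int.cast_neg]; exact abs_of_neg (by exact_mod_cast hk0)
      have hrk : row k = row (-k) := by
        simp only [hrow, hFq]
        exact (row_neg t₁ t₂ T k).symm
      have hgk : ENNReal.ofReal (g k) = ENNReal.ofReal (truncWeight T (-k) *
          (C * (t₂ - t₁) + M₀ * (((-k : ℤ) : ℝ) / 2) ^ 2 * logPlus (((-k : ℤ) : ℝ) / 2) ^ α)) := by
        simp only [hg, hkr, truncWeight_neg]
      rw [hrk, hgk]
      simp only [hrow, hFq]
      exact h
  have hsmall : ∀ k : ℤ, |k| < K₀ → row k < ⊤ := by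
    intro k hk
    rcases eq_or_ne k 0 with rfl | hk0
    · have : row 0 = 0 := by
        rw [hrow]
        simp only
        refine ENNReal.tsum_eq_zero.2 fun j ↦ ?_
        rw [Set.indicator_of_notMem]
        simp [mem_zstarOffDiag]
      rw [this]; exact ENNReal.zero_lt_top
    · exact row_lt_top_of_small (T := T) hreal ht₀ hT hC hfar (by omega) hK₀ hk0 hk
  have hrowsum : ∑' k : ℤ, row k < ⊤ := by
    set S : Finset ℤ := Finset.Ioo (-(K₀ : ℤ)) K₀ with hS
    have hle : ∀ k, row k ≤ (S : Set ℤ).indicator row k + ENNReal.ofReal (g k) := by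
      intro k
      by_cases hkS : k ∈ S
      · rw [Set.indicator_of_mem (Finset.mem_coe.2 hkS)]; exact le_self_add
      · have hkS' : k ∉ (S : Set ℤ) := by simpa using hkS
        rw [Set.indicator_of_notMem hkS', zero_add]
        refine hbig k ?_
        rw [hS, Finset.mem_Ioo, not_and_or, not_lt, not_lt] at hkS
        rcases hkS with h | h
        · exact le_abs.2 (Or.inr (by omega))
        · exact le_abs.2 (Or.inl h)
    have h1 : ∑' k, (S : Set ℤ).indicator row k < ⊤ := by
      rw [← sum_eq_tsum_indicator]
      refine ENNReal.sum_lt_top.2 fun k hk ↦ hsmall k ?_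
      rw [hS, Finset.mem_Ioo] at hk
      exact abs_lt.2 ⟨by omega, by omega⟩
    have h2 : ∑' k, ENNReal.ofReal (g k) < ⊤ := by
      rw [← ENNReal.ofReal_tsum_of_nonneg hg0 hgsum]; exact ENNReal.ofReal_lt_top
    calc ∑' k, row k ≤ ∑' k, ((S : Set ℤ).indicator row k + ENNReal.ofReal (g k)) :=
          ENNReal.tsum_le_tsum hle
      _ = (∑' k, (S : Set ℤ).indicator row k) + ∑' k, ENNReal.ofReal (g k) := ENNReal.tsum_add
      _ < ⊤ := ENNReal.add_lt_top.2 ⟨h1, h2⟩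
  -- Step 3: the `t`-free part
  have htfree : ∑' p : zstarOffDiag, ENNReal.ofReal (Kc * a p.1.1 * a p.1.2) ≠ ⊤ := by
    have h1 : ∑' p : zstarOffDiag, ENNReal.ofReal (Kc * a p.1.1 * a p.1.2) ≤
        ∑' q : ℤ × ℤ, ENNReal.ofReal (Kc * a q.1 * a q.2) := by
      rw [tsum_subtype zstarOffDiag (fun q : ℤ × ℤ ↦ ENNReal.ofReal (Kc * a q.1 * a q.2))]
      exact ENNReal.tsum_le_tsum fun q ↦ Set.indicator_le_self _ _ q
    have h2 : ∑' q : ℤ × ℤ, ENNReal.ofReal (Kc * a q.1 * a q.2) =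
        ENNReal.ofReal Kc * ((∑' j : ℤ, ENNReal.ofReal (a j)) * ∑' k : ℤ, ENNReal.ofReal (a k)) := by
      rw [ENNReal.tsum_prod']
      simp only
      have : ∀ j k : ℤ, ENNReal.ofReal (Kc * a j * a k) =
          ENNReal.ofReal Kc * (ENNReal.ofReal (a j) * ENNReal.ofReal (a k)) := by
        intro j k
        rw [ENNReal.ofReal_mul (mul_nonneg hKc (ha0 j)), ENNReal.ofReal_mul hKc, mul_assoc]
      simp_rw [this, ENNReal.tsum_mul_left, ENNReal.tsum_mul_right]
    have h3 : ∑' j : ℤ, ENNReal.ofReal (a j) = ENNReal.ofReal (∑' j, a j) :=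
      (ENNReal.ofReal_tsum_of_nonneg ha0 hasum).symm
    refine ne_top_of_le_ne_top ?_ h1
    rw [h2, h3]
    exact ENNReal.mul_ne_top ENNReal.ofReal_ne_top (ENNReal.mul_ne_top ENNReal.ofReal_ne_top ENNReal.ofReal_ne_top)
  -- Step 4: assemble
  rw [lintegral_tsum fun p ↦ aemeasurable_truncEnergyTerm hreal ht₀ T p]
  have hsum : ∑' p : zstarOffDiag, ∫⁻ t in Icc t₁ t₂, ENNReal.ofReal (truncEnergyTerm T t p) ≤
      2 * (∑' k : ℤ, row k) + (∑' p : zstarOffDiag, ENNReal.ofReal (Kc * a p.1.1 * a p.1.2)) * V := by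
    calc ∑' p : zstarOffDiag, ∫⁻ t in Icc t₁ t₂, ENNReal.ofReal (truncEnergyTerm T t p)
        ≤ ∑' p : zstarOffDiag, (2 * Fq p.1 + ENNReal.ofReal (Kc * a p.1.1 * a p.1.2) * V) :=
          ENNReal.tsum_le_tsum hterm
      _ = 2 * (∑' p : zstarOffDiag, Fq p.1) +
            (∑' p : zstarOffDiag, ENNReal.ofReal (Kc * a p.1.1 * a p.1.2)) * V := by
          rw [ENNReal.tsum_add, ENNReal.tsum_mul_left, ENNReal.tsum_mul_right]
      _ = _ := by rw [hrows]
  refine ne_top_of_le_ne_top ?_ hsum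
  exact ENNReal.add_ne_top.2 ⟨ENNReal.mul_ne_top (by norm_num) hrowsum.ne,
    ENNReal.mul_ne_top htfree hVlt.ne⟩

end RodgersTaoTruncEnergyIntegrable

open RodgersTaoTruncEnergyIntegrable in
/-- **Rodgers–Tao 2020, Lemma 18 (FMP p. 42, display (67)) — the a.e.-finiteness clause, CONTENT
form above a real-rooted time.** «… the quantity `Ẽ_T(t) := Σ_{j,k ∈ ℤ* : j ≠ k} ψ_T(j)ψ_T(k)Ẽ_{jk}(t)`
… is finite for almost every `Λ/2 ≤ t ≤ 0`» — here on any `[t₁, t₂]` with `Λ ≤ t₀ < t₁ < t₂`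
under the location law (50) on `[t₁, t₂]` (the INNER shape of `RodgersTao2020.cor33_location`, as
consumed by `rodgers_tao_weak_energy_bound_block_of`), for every `T` with `T log T > 0`:
`Summable (truncEnergyTerm T t)` for a.e. `t ∈ [t₁, t₂]`.  Proof = the printed one («by Tonelli»
from Proposition 15): `lintegral_tsum_truncEnergyTerm_ne_top` + `ae_lt_top'`. RH-FREE.
[cite: RodgersTaoFMP2020, Lemma 18 p. 42 (67); Proposition 15 pp. 38–39] -/
theorem RodgersTao2020.ae_summable_truncEnergyTerm_of_location {t₀ t₁ t₂ B : ℝ}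
    (hreal : HasOnlyRealZeros (deBruijnH t₀)) (ht₀ : t₀ < t₁) (h12 : t₁ < t₂)
    (H2 : ∀ t ∈ Set.Icc t₁ t₂, ∀ n : ℕ, 1 ≤ n →
      |deBruijnZero t n - classicalLocation (n : ℝ)| ≤ B * logPlus (classicalLocation (n : ℝ)))
    {T : ℝ} (hT : 0 < T * Real.log T) :
    ∀ᵐ t ∂(volume.restrict (Set.Icc t₁ t₂)), Summable (truncEnergyTerm T t) := by
  have hne := lintegral_tsum_truncEnergyTerm_ne_top hreal ht₀ h12 H2 hT
  have hmeas : AEMeasurable (fun t ↦ ∑' p : zstarOffDiag, ENNReal.ofReal (truncEnergyTerm T t p))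
      (volume.restrict (Icc t₁ t₂)) :=
    AEMeasurable.tsum fun p ↦ aemeasurable_truncEnergyTerm hreal ht₀ T p
  filter_upwards [ae_lt_top' hmeas hne, ae_restrict_mem measurableSet_Icc] with t ht htI
  have hΛ : ∃ t₁' : ℝ, t₁' < t ∧ HasOnlyRealZeros (deBruijnH t₁') := ⟨t₀, by linarith [htI.1], hreal⟩
  exact summable_of_tsum_ofReal_ne_top
    (fun p ↦ truncEnergyTerm_nonneg hT (strictMono_deBruijnZeroZ hΛ) p) ht.ne

/-- **Rodgers–Tao 2020, Lemma 18 (67), a.e.-finiteness of `Ẽ_T` on `[t₀/2, 0]` from Corollary 10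
(50)** — CONTENT form, exactly the hypothesis `hfin` of
`rodgers_tao_truncEnergy_expansion_of_cor33_location`: for `t₀ < 0` with `H_{t₀}` real-rooted and
every `T ≥ 3`, `Ẽ_T(t) < ∞` for a.e. `t ∈ [t₀/2, 0]`. RH-FREE (no use of `Λ ≥ 0`).
[cite: RodgersTaoFMP2020, Lemma 18 p. 42 (67); Corollary 10 (50) p. 23; Proposition 15 pp. 38–39] -/
theorem ae_summable_truncEnergyTerm_of_cor33_location (h50 : RodgersTao2020.cor33_location) :
    ∀ t₀ : ℝ, t₀ < 0 → HasOnlyRealZeros (deBruijnH t₀) →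
      ∃ T₁ : ℝ, ∀ T : ℝ, T₁ ≤ T →
        ∀ᵐ t ∂(volume.restrict (Set.Icc (t₀ / 2) 0)), Summable (truncEnergyTerm T t) := by
  intro t₀ ht₀ hreal
  obtain ⟨A50, hA50⟩ := h50
  refine ⟨3, fun T hT ↦ ?_⟩
  have hTlog : 0 < T * Real.log T := by
    have h1 : (1 : ℝ) < T := by linarith
    exact mul_pos (by linarith) (Real.log_pos h1)
  have H2 : ∀ t ∈ Set.Icc (t₀ / 2) 0, ∀ n : ℕ, 1 ≤ n →
      |deBruijnZero t n - classicalLocation (n : ℝ)| ≤ A50 * logPlus (classicalLocation (n : ℝ)) :=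
    fun t ht n hn ↦ hA50 t ⟨t₀, by linarith [ht.1], hreal⟩ ht.2 n hn
  exact RodgersTao2020.ae_summable_truncEnergyTerm_of_location hreal (by linarith) (by linarith) H2 hTlog

end Literature.NumberTheory.LFunctions

end
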